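import Literature.MathematicalPhysics.QuantumFieldTheory.BalabanImbrieJaffe1984to88.BIJ88Close231RegularTorusCwt
import Literature.MathematicalPhysics.QuantumFieldTheory.BalabanImbrieJaffe1984to88.BIJ88LocDerivHolder230FlatTorus
import Literature.MathematicalPhysics.QuantumFieldTheory.BalabanImbrieJaffe1984to88.BIJ85NeumannPropagatorRegularHolder

/-!
# `BalabanImbrieJaffe1984to88.BIJ88LocDerivHolder230RegularTorus` — T. Bałaban, J. Imbrie, A. Jaffe, *Effective action and cluster properties
of the abelian Higgs model*, Commun. Math. Phys. **114** (1988) 257–315 [BalabanImbrieJaffe1988], Sect. 2 p. 263 [PDF 7], (2.27)–(2.30) and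
the sentence after (2.33): **THE HÖLDER MEMBER OF TOP ORDER `1 + θ` (`0 ≤ θ < 1`) OF (2.30) AT A (2.23)-REGULAR NON-FLAT BACKGROUND
`u = e^{ieεA}`, FOR THE PRINTED LOCALIZATION DATA WITH BIG-BLOCK CUBES** (r18 gen 24's `BIJ88Close231RegularTorusCwt`: the big-block hulls
`cubeFamB` of p29 gen 26's torus cubes, the weights `λ_α` of (2.27)) **AND A CUT-OFF SMOOTH IN THE LATTICE POINT** (r18's product form
`ζ^Π(R₁, R₀)`; print: *"ζ_k(x₁, x₂) is a smooth function of x₁ − x₂"*): the gauge-covariant Hölder quotient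
`(L^k/|x₁ − x₂|_T)^θ·|U(A(Γ_{x₁x₂}))(D_uG_{k,loc}(u)f)(x₂, μ) − (D_uG_{k,loc}(u)f)(x₁, μ)|` of the COVARIANT DERIVATIVE of `G_{k,loc}(u)f`, the
transport `U(A(Γ)) = e^{ieεA(Γ)}` taken along a nearest-neighbour contour `Γ` AT THE NON-FLAT FIELD ([6] p. 573: *"Γ_{x,x′} a shortest contour"*),
obeys `(L^kε)·c₀·m·(1 + L^k((R₀−R₁)⁻¹ + s_g⁻¹))²·e^{−δ₀D/L^k}‖f‖_∞` — the REGULAR-`u` twin of p29 gen 28's flat `BIJ88LocDerivHolder230FlatTorus`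
and of p29 gen 29's small-`u` `BIJ88LocDerivHolder230SmallFieldTorus`, on this seat's regular-background lineage (value / covariant-derivative
members `opDecay230_regular_cwt` / `deriv230_regular_cwt`; p29's Hölder `θ ≤ 1` member `BIJ88LocHolder230RegularTorus`).  With it every member of
the p. 263 sentence *"covariant derivatives and Hölder derivatives of G_{k,loc}(u) of order less than two"* for (2.30) is in the tree at the
(2.23)-regular background.

statement-level skeleton of published theorems with citation tags; proofs where landed; nothing here is a claim about the Yang–Mills mass gap

PDF held: `paper:balaban1988-cmp114-bij-abelian-higgs-effective-action` (journal page = PDF page + 256); p. 263 [PDF 7] re-read this session on the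
materialised text layer (`lit read … --pages 4-9`); [6] = T. Bałaban, *Regularity and decay of lattice Green's functions*, Commun. Math. Phys. **89**
(1983) 571–597 [Balaban1983RegularityDecay], (1.4) p. 572 / (1.9) p. 573 through r01 gen 26's `BIJ85NeumannPropagatorRegularHolder`.

CITATION HEADER (lean-in-tree rule).  lit-balaban cell (HOME `run/shared/lean/pub/lit-balaban/`), Phase 2, seat r18 gen 25 (unit `lit-balaban-r18`,
literature-prover-lit-balaban-r18-g25-0; C2 §§1–4 fold owner), free-target protocol G.5-34(d), TAKING line HOME/STATUS.md 2026-08-23T04:40:17Z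
(item (γ′) of the owner's `HOME/lit-balaban-r18/C2S14-CLOSURE.md` v1.16u §5 *"the order-(1+θ) Hölder MEMBER for G_{k,loc}(u) at non-flat u"*,
regular-`u` twin; p29 g29 «NO objection» 04:42:55Z (he holds the small-`u` twin, p353037), r01 g35 «NO objection … NOT in the tree» 04:52:52Z on
the `holA` telescoping).  Rows of `HOME/lit-balaban-r18/ROWS-C2.md` served (LOCATED MEMBERS, cells only; heads unchanged): **C2.Claim@263**
p. 263 (head = p08's abstract hence-step `BIJ88HolderDecay230`), **C2.Eq2.30** (head p02's `BIJ88OpDecay230Proof`).  Kind: theorems only (no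
definition, no `Prop`-valued fact).  Files USED BY NAME, nothing restated: r01 g26 `BIJ85NeumannPropagatorRegularHolder` (`IsSChain`, `SNbr`,
`bondSum`, `holA`, `holA_nil`, `holA_cons`, `norm_holA`, **`input19_holder_regular_deep`** = [6] (1.9) at regular `A` for big-block regions;
p348815), r01 g26 `BIJ85NeumannPropagatorRegularDeriv` (**`input110_deriv_regular_deep`**; p347438), r18 g24 `BIJ88Close231RegularTorusCwt`
(`bbHull`, `bbHull_bigBlock`, `cubeFamB`, `deepRows`, `rowMargin`, `rowHyp_ii_hull`, **`inputs_regular`**; p347978–p350995), p29 g28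
`BIJ88LocDerivHolder230FlatTorus` (**`abs_weight_shift_sub_le_of_hull`**, **`abs_weight_bondDiff_sub_le_of_hull`**; p344675/p346553), p29 g27/28
`BIJ88LocDeriv230FlatTorus` (`covD_gLocT_apply`, `T_shift_le_one`, `abs_T_shift_sub_le`), `BIJ88LocDeriv230ZetaPiFlatTorus`
(`norm_rowSource_sub_le_of_lipschitz`, `zetaPi_zero_eq_zero_of_le`, `abs_zetaPi_zero_le_one`, `abs_zetaPi_zero_shift_sub_le`,
`abs_zetaPi_zero_secondDiff_le`), r18 g20 `BIJ88HkLocHolderTorus` (`zetaPi`, `secondDiffConst`), p31 (`gBox`, `gLocT`, `cubeT`, `boxCoord`,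
`norm_rowSource_le`, `rowSource_ne_zero`, `abs_lam_le_one`), p29 g26 `BIJ88LocWeights227Torus` (`labels`, `lamFam`, `lamT`, `activeLabels`,
`mem_activeLabels_of_ne_zero_of_deep`, `card_subtype_activeLabels_le`, `mem_and_abs_sub_le_of_T_le`, `sum_abs_lamT_le_one`), r01's dictionary
`BIJ85CovariantHiggsDictionary.expGauge`/`toC_expGauge`, b04 `B4GaugeCovariance.pathEnd`, p38's metric `B5Ineq137Torus.T`, r18's
`BIJ88Sect3Statements.covD`/`cfg`/`toC`, `Literature.Analysis.Calculus.exists_abs_deriv_and_deriv_deriv_smoothTransition_le`.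

THE PRINTED TEXT (verbatim, p. 263).  *"G̃_k(u; x₁, x₂) = Σ_α λ_αG_k(□_α, u; x₁, x₂), (2.27) as a convex combination of Neumann propagators. …
G_{k,loc}(u; x₁, x₂) = ζ_k(x₁, x₂)G̃_k(u; x₁, x₂), (2.28) where ζ_k(x₁, x₂) is a smooth function of x₁ − x₂ … (2.29) … |(G_{k,loc}(u)f)(x)| ≦
ce^{−c dist(suppt f,x)}‖f‖_∞, (2.30) … We assume that u is smooth in the □_α's entering the sum in (2.27) … This means that in a neighborhood of
each □_α there exists an A, λ such that u = exp[ie_kη(A + ∂λ)] with |∂A|, |∂*A| ≦ O(p(e_k)). (2.32) … Bounds analogous to (2.30), (2.31) hold for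
covariant derivatives and Holder derivatives of G_{k,loc}(u) of order less than two."*  [6] p. 572–573: *"for an arbitrary contour Γ in the
lattice we define A(Γ) = Σ_{b⊂Γ} A_b … let us denote by Γ_{x,x′} a shortest contour connecting these points. …
|x − x′|^{−α}|U(A(Γ_{x,x′}))(D^η_{A,μ}G_k(Ω, A)f)(x′) − (D^η_{A,μ}G_k(Ω, A)f)(x)| ≦ c₀exp(−δ₀ dist({x, x′}, supp f))‖f‖_∞ (1.9) for x, x′ ∈ Ω, and
satisfying the condition dist({x, x′}, Ω^c) ≧ R₀."*  *"Smooth"* `u` is taken in the (2.23)-regular form of [BalabanImbrieJaffe1985] p. 326 / [6]: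
`u = e^{ieεA}` with `L^kε|e|/e_k·|∂A| ≦ c·e_k^{β−1}/L^k` on the whole torus, `0 < e_k ≦ e₁` (r18 gen 24's HONEST SCOPE (ii), inherited).

WHAT IS PROVED (theorems only; 0 `sorry`; standard axioms).
* §1 KERNEL — the transport at the non-flat field along r01's contours: `bondSum_shift` / `bondSum_unshift` (the pair form «A(x, x+e_μ) = A_b»,
  «A_{b̄} = −A_b» on the `Setup` torus with more than two sites per direction), **`T_le_length_of_isSChain`** (every contour site is
  within `|Γ|` of the initial point), **`norm_holA_mul_sub_le`**: `‖U(A(Γ))φ(x′) − φ(x)‖ ≤ ε·|Γ|·B` whenever `‖(D_uφ)(⟨z, ν⟩)‖ ≤ B` at every contour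
  site `z` and direction `ν` — bond by bond through `holA_cons`, a forward step costing `‖u_bφ(b₊) − φ(b₋)‖ = ε‖(D_uφ)(b)‖` and a backward step
  the same (`|u_b| = 1`).
* §2 **`deriv230_regular_of_lipschitz`** — the covariant-derivative analogue of (2.30) at the regular `u` for the data with a GENERIC Lipschitz
  cut-off (`|ζ″| ≤ 1`, `ζ″ = 0` beyond `R₀`, one-step modulus `K₁/(R₀−R₁)`): r18 gen 24's `deriv230_regular_cwt` (p13's cut-off of record) VERBATIM
  with the cut-off abstracted — the far-pair input of §3 and the order-`1` member for `ζ^Π` (§4).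
* §3 **`derivHolder230_regular_of_smooth`** — `∃ s₀ ∀ s ≥ s₀ ∃ c₀ e₁ > 0` (from `(d, L, a, e, c, β, θ, K₁, K₂, s)` only) such that on every torus
  of the series (`P.d = d+1`, `P.L = L ≥ 2`), at every level `1 ≤ k ≤ K` with `k + s ≤ m + K`, `3L^kL^s ≤ |T^{(0)}|`, for every `A` (2.23)-regular on
  `T^{(0)}` (`0 < e_k ≤ e₁`), every reference no-wrap box `Ω₀ = c·L^k + Π_i[0, L^kM₀_i)` shorter than the torus with torus gap `≥ R`, grid spacing
  `s_g ≥ 1`, half-width `W ≥ 2s_g/3 + R₀/2 + R`, radii `R > rowMargin + (d+2)L^k + 1`, `0 ≤ R₁ < R₀`, EVERY real cut-off `ζ″` with `|ζ″| ≤ 1`,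
  `ζ″(x,y) = 0` for `|x − y|_T ≥ R₀`, first lattice differences in `x` `≤ K₁/(R₀−R₁)` and mixed second ones `≤ K₂/(R₀−R₁)²`, every direction `μ`,
  all bonds `⟨x₁,x₁+e_μ⟩`, `⟨x₂,x₂+e_μ⟩` with their four end points in `Ω₀` at chart depth `≥ R₀ + R`, every nearest-neighbour contour
  `Γ = (x₁, l)` (r01's `IsSChain`) ending at `x₂` with `|Γ| ≤ (d+1)|x₁ − x₂|_T`, and every `f` (`‖f‖_∞ ≤ F`) supported at sup-torus distance
  `≥ D ≥ 0` from `x₁` and `x₂`: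
  `(L^k/|x₁−x₂|_T)^θ·‖U(A(Γ))(D_uG_{k,loc}(u)f)(x₂,μ) − (D_uG_{k,loc}(u)f)(x₁,μ)‖ ≤ (L^kε)·c₀·m·(1 + L^k((R₀−R₁)⁻¹ + s_g⁻¹))²·e^{−δ₀D/L^k}·F`,
  `δ₀ = 1/(8L^s)`, `m = (⌊(L^k − 1 + R₀)/s_g⌋ + 3)^{d+1}`, `(D_uψ)(x,μ) = ε⁻¹(u_{⟨x,x+e_μ⟩}ψ(x+e_μ) − ψ(x))`, `U(A(Γ)) = holA e A x₁ l`.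
  MECHANISM = p29 gen 28's four-term split at the regular background (near pairs `|x₁ − x₂|_T ≤ L^k`): the bond identity `covD_gLocT_apply` at
  both bonds and — (A) [6] (1.9) at the regular `u` for each hull active at `x₂+e_μ` on its fixed row source (r01's `input19_holder_regular_deep`,
  rows `x₁`, `x₂`), (B) [6] (1.10)'s DERIVATIVE member at `⟨x₁,x₁+e_μ⟩` on the difference of the row sources of `x₂+e_μ`, `x₁+e_μ` (r01's
  `input110_deriv_regular_deep`; Lipschitz along the chart hull, `abs_weight_shift_sub_le_of_hull`), (C) the transported difference of the VALUES
  of the hull propagators on the bond-difference source of `x₂`, telescoped ALONG `Γ` AT THE NON-FLAT `u` (`norm_holA_mul_sub_le`) with (1.10)'s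
  derivative member per bond at the contour sites — all `rowMargin`-deep in the active hulls because they lie within `|Γ| ≤ (d+1)|x₁−x₂|_T ≤
  (d+1)L^k` of `x₁` (`T_le_length_of_isSChain`; whence the margin `(d+2)L^k + 1` in `R`), (D) (1.10)'s VALUE member (r18's `inputs_regular`) on the
  SECOND difference of the row weights (`abs_weight_bondDiff_sub_le_of_hull`); far pairs: two order-`1` members (§2), `|U(A(Γ))| = 1`;
  coincident points: `|Γ| ≤ 0` forces `Γ = ∅`, `U = 1`.
* §4 **`derivHolder230_regular_zetaPi`** — §3 for `ζ″ = ζ^Π(R₁, R₀)` (`1 ≤ R₁ < R₀ ≤ (|T^{(0)}| − 3)/2`), constants from `(d, L, a, e, c, β, θ, s)`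
  and the tree's universal bound `C_σ` on `|σ′|`, `|σ″|`; **`deriv230_regular_zetaPi`** — the order-`1` member (§2) for `ζ^Π`.
HONEST SCOPE / DIVERGENCE.  (i) `u` is EXACTLY `e^{ieεA}` with `A` (2.23)-regular ON THE WHOLE TORUS (r18 gen 24's HONEST SCOPE (ii); no change of
gauge — the `_gaugeOrbit` forms of `BIJ88Close231RegularTorusCwt` v1.4 are not restated; bondwise/plaquette-small `u` beyond the regular class
is p29's `BIJ88LocDerivHolder230SmallFieldTorus`).  (ii) THE CUBES ARE r18's BIG-BLOCK HULLS `cubeFamB` (r18's divergence (iv)); `G_{k,loc}(u)` is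
the (2.28) object of THAT family; deep bonds only (chart depth `≥ R₀ + R`, `R > rowMargin + (d+2)L^k + 1 = O(L^kL^s)` — print's *"O(r(e_k))"*
margin in `L^k`-units once `L^s ≲ r(e_k)`).  (iii) The cut-off must be C^{1,1} IN THE LATTICE POINT (second differences `O((R₀−R₁)⁻²)`): p13's
cut-off of record `σ((R₀ − |x−y|_T)/(R₀−R₁))` is only Lipschitz in `x` and is covered by §2 (order `1`) but NOT by §3; r18's `ζ^Π` is (§4) — both
satisfy the printed (2.29) (p29 gen 28's scope note (ii), inherited).  (iv) The transport is [6]'s `U(A(Γ))` along ANY nearest-neighbour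
contour of length `≤ (d+1)|x₁ − x₂|_T` in r01's list vocabulary (`IsSChain`/`pathEnd`/`holA`) — the vocabulary of the (1.9) input; every
shortest contour qualifies; p29's `θ ≤ 1` regular members use T4's `chainHol` instead (same object, different bookkeeping; no bridge is
claimed here).  (v) Constants: `s₀, c₀, e₁` existential (r01's/p35's thresholds; `c₀ = c_H + C_B + C_C + C_D + 2c_g` with `C_C` carrying
`e^{(d+1)/(4L^s)}` for the contour-site support loss), `δ₀ = 1/(8L^s)` explicit (r01's `1/(4L^s)` weakened); the bracket
`(1 + L^k((R₀−R₁)⁻¹ + s_g⁻¹))` SQUARED as in the flat member; no non-vacuity instance (the hypotheses are those of gen 24's §8 witness plus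
`R > rowMargin + (d+2)L^k + 1`, met the same way on a longer torus — not spelled out).  (vi) `set_option maxHeartbeats 800000` on §3's theorem
(elaboration budget only; long bookkeeping, no heavy automation).  Imports: r18 g24 `BIJ88Close231RegularTorusCwt` (→ r01 `…RegularClose`/
`…RegularDeriv`, p31, p29 g26/27, r18 g23), p29 g28 `BIJ88LocDerivHolder230FlatTorus` (→ `BIJ88LocHolder230FlatTorus`, `BIJ88LocDeriv230ZetaPiFlatTorus`,
`BIJ88ConvexWeights227SecondDiff`, r18 `BIJ88HkLocHolderTorus`), r01 g26 `BIJ85NeumannPropagatorRegularHolder`.  Literature + Mathlib only.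
Unit `lit-balaban-r18` (literature-prover-lit-balaban-r18-g25-0), 2026-08-23.  NOT summit progress.
-/

open scoped BigOperators Matrix ComplexConjugate
open Finset Matrix

namespace Literature.MathematicalPhysics.QuantumFieldTheory.BalabanImbrieJaffe1984to88.BIJ88LocDerivHolder230RegularTorus

open Literature.MathematicalPhysics.QuantumFieldTheory.Balaban1983to89
open BIJ88Sect3Statements (U1 toC cfg covD norm_toC)
open BIJ85BlockAveragesTorus BIJ85BlockAveragesTorusK
open BIJ88NeumannPropagator227Torus (gBox)
open BIJ88DeltaLoc234Torus (gLocT)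
open BIJ88NeumannPropagatorFlatDecayCube
open BIJ88LocWeights227Torus
open BIJ85CovariantHiggsDictionary (expGauge toC_expGauge)
open BIJ85NeumannPropagatorRegularHolder (SNbr IsSChain bondSum holA holA_nil holA_cons norm_holA input19_holder_regular_deep)
open BIJ88LocDeriv230FlatTorus (T_shift_le_one abs_T_shift_sub_le)
open B4GaugeCovariance (pathEnd)

noncomputable section

variable {d : ℕ} {P : Params}

/-! ## §1 Kernel: the transport `U(A(Γ))` telescoped along a nearest-neighbour contour at the non-flat field -/

section Transport

/-- kernel: `1 ≠ 0` in the label ring `ZMod |T|` (more than one site per direction). [folklore] -/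
private theorem one_ne_zero_zmod : (1 : ZMod (P.sitesPerDir 0)) ≠ 0 := by
  intro h
  have h3 := (ZMod.natCast_eq_zero_iff 1 (P.sitesPerDir 0)).1 (by exact_mod_cast h)
  have h4 := Nat.le_of_dvd one_pos h3
  have h5 := P.one_lt_sitesPerDir 0
  omega

/-- kernel: `2 ≠ 0` in `ZMod |T|` when there are more than two sites per direction. [folklore] -/
private theorem two_ne_zero_zmod (hS : 2 < P.sitesPerDir 0) : (2 : ZMod (P.sitesPerDir 0)) ≠ 0 := by
  intro h
  have h3 := (ZMod.natCast_eq_zero_iff 2 (P.sitesPerDir 0)).1 (by exact_mod_cast h)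
  have h4 := Nat.le_of_dvd two_pos h3
  omega

/-- kernel: `x + e_μ ≠ x` on a torus with more than one site per direction. [folklore] -/
private theorem shift_ne_self (x : Balaban1983to89.Site P 0) (μ : Fin P.d) : x.shift μ ≠ x := by
  intro h
  have h1 := congrFun h μ
  simp only [Balaban1983to89.Site.shift, Function.update_self] at h1
  exact one_ne_zero_zmod (P := P) (add_eq_left.1 h1)

/-- kernel: the direction of a unit step is determined by its end points. [folklore] -/
private theorem eq_of_shift_eq_shift {x : Balaban1983to89.Site P 0} {μ ν : Fin P.d} (h : x.shift μ = x.shift ν) : μ = ν := by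
  by_contra hne
  have h1 := congrFun h μ
  simp only [Balaban1983to89.Site.shift, Function.update_self, Function.update_of_ne hne] at h1
  exact one_ne_zero_zmod (P := P) (add_eq_left.1 h1)

/-- kernel: `x + e_μ + e_ν ≠ x` on a torus with more than two sites per direction. [folklore] -/
private theorem shift_shift_ne_self (hS : 2 < P.sitesPerDir 0) (x : Balaban1983to89.Site P 0) (μ ν : Fin P.d) :
    (x.shift μ).shift ν ≠ x := by
  intro h
  by_cases hμν : ν = μ
  · subst hμν
    have h1 := congrFun h ν
    simp only [Balaban1983to89.Site.shift, Function.update_self] at h1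
    rw [add_assoc, show (1 : ZMod (P.sitesPerDir 0)) + 1 = 2 by norm_num] at h1
    exact two_ne_zero_zmod hS (add_eq_left.1 h1)
  · have h1 := congrFun h μ
    have hμν' : μ ≠ ν := fun h' => hμν h'.symm
    simp only [Balaban1983to89.Site.shift, Function.update_of_ne hμν', Function.update_self] at h1
    exact one_ne_zero_zmod (P := P) (add_eq_left.1 h1)

/-- kernel: **the pair form on a forward bond**: `A(x, x + e_μ) = A_{⟨x,μ⟩}` (more than two sites per direction).
[cite: Balaban1983RegularityDecay, p.572 «A(Γ) = Σ_{b⊂Γ} A_b»] -/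
theorem bondSum_shift (hS : 2 < P.sitesPerDir 0) (A : PBond P 0 → ℝ) (x : Balaban1983to89.Site P 0) (μ : Fin P.d) :
    bondSum A x (x.shift μ) = A ⟨x, μ⟩ := by
  unfold bondSum
  rw [Finset.sum_sub_distrib]
  have h1 : ∑ ν : Fin P.d, (if x.shift μ = x.shift ν then A ⟨x, ν⟩ else 0) = A ⟨x, μ⟩ := by
    rw [Finset.sum_eq_single μ]
    · rw [if_pos rfl]
    · intro ν _ hνμ
      rw [if_neg]
      exact fun h => hνμ (eq_of_shift_eq_shift h).symm
    · intro h; exact absurd (Finset.mem_univ μ) h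
  have h2 : ∑ ν : Fin P.d, (if x = (x.shift μ).shift ν then A ⟨x.shift μ, ν⟩ else 0) = 0 := by
    refine Finset.sum_eq_zero fun ν _ => ?_
    rw [if_neg]
    exact fun h => shift_shift_ne_self hS x μ ν h.symm
  rw [h1, h2, sub_zero]

/-- kernel: **the pair form on a backward bond**: `A(x + e_μ, x) = −A_{⟨x,μ⟩}` («A_{b̄} = −A_b»; more than two sites per direction).
[cite: Balaban1983RegularityDecay, p.576 «A_{b̄} = −A_b»] -/
theorem bondSum_unshift (hS : 2 < P.sitesPerDir 0) (A : PBond P 0 → ℝ) (x : Balaban1983to89.Site P 0) (μ : Fin P.d) :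
    bondSum A (x.shift μ) x = -A ⟨x, μ⟩ := by
  unfold bondSum
  rw [Finset.sum_sub_distrib]
  have h1 : ∑ ν : Fin P.d, (if x = (x.shift μ).shift ν then A ⟨x.shift μ, ν⟩ else 0) = 0 := by
    refine Finset.sum_eq_zero fun ν _ => ?_
    rw [if_neg]
    exact fun h => shift_shift_ne_self hS x μ ν h.symm
  have h2 : ∑ ν : Fin P.d, (if x.shift μ = x.shift ν then A ⟨x, ν⟩ else 0) = A ⟨x, μ⟩ := by
    rw [Finset.sum_eq_single μ]
    · rw [if_pos rfl]
    · intro ν _ hνμ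
      rw [if_neg]
      exact fun h => hνμ (eq_of_shift_eq_shift h).symm
    · intro h; exact absurd (Finset.mem_univ μ) h
  rw [h1, h2, zero_sub]

/-- kernel: one forward step of the transport is `ε` times the covariant derivative: `u_b φ(b₊) − φ(b₋) = ε·(D_uφ)(b)`.
[cite: BalabanImbrieJaffe1988, (3.2) p.265] -/
private theorem norm_step_forward (e : ℝ) (A : PBond P 0 → ℝ) (φ : Balaban1983to89.Site P 0 → ℂ) (x : Balaban1983to89.Site P 0)
    (μ : Fin P.d) :
    ‖toC (expGauge P e A ⟨x, μ⟩) * φ (x.shift μ) - φ x‖ = P.eps * ‖covD P.eps⁻¹ (cfg (expGauge P e A)) φ ⟨x, μ⟩‖ := by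
  have heps : 0 < P.eps := P.eps_pos
  have h1 : covD P.eps⁻¹ (cfg (expGauge P e A)) φ ⟨x, μ⟩ = ((P.eps⁻¹ : ℝ) : ℂ) * (toC (expGauge P e A ⟨x, μ⟩) * φ (x.shift μ) - φ x) := rfl
  rw [h1, norm_mul, Complex.norm_real, Real.norm_eq_abs, abs_of_pos (inv_pos.2 heps), ← mul_assoc, mul_inv_cancel₀ heps.ne', one_mul]

/-- kernel: one backward step: `ū_b φ(b₋) − φ(b₊)` has the norm of `u_b φ(b₊) − φ(b₋) = ε·(D_uφ)(b)` (`|u_b| = 1`).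
[cite: BalabanImbrieJaffe1988, (3.2) p.265] -/
private theorem norm_step_backward (e : ℝ) (A : PBond P 0 → ℝ) (φ : Balaban1983to89.Site P 0 → ℂ) (x : Balaban1983to89.Site P 0)
    (μ : Fin P.d) :
    ‖(starRingEnd ℂ) (toC (expGauge P e A ⟨x, μ⟩)) * φ x - φ (x.shift μ)‖ =
      P.eps * ‖covD P.eps⁻¹ (cfg (expGauge P e A)) φ ⟨x, μ⟩‖ := by
  rw [← norm_step_forward e A φ x μ]
  set u : ℂ := toC (expGauge P e A ⟨x, μ⟩) with hu
  have hu1 : ‖u‖ = 1 := norm_toC _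
  have hcu : (starRingEnd ℂ) u * u = 1 := by
    rw [Complex.conj_mul', hu1]; norm_num
  have e1 : (starRingEnd ℂ) u * φ x - φ (x.shift μ) = -((starRingEnd ℂ) u * (u * φ (x.shift μ) - φ x)) := by
    rw [mul_sub, ← mul_assoc, hcu, one_mul]; ring
  rw [e1, norm_neg, norm_mul, Complex.norm_conj, hu1, one_mul]

/-- kernel: `e^{−isI}`-type identity: `exp((−t)·I) = conj(exp(t·I))` for real `t`. [folklore] -/
private theorem exp_neg_mul_I (t : ℝ) : Complex.exp (((-t : ℝ) : ℂ) * Complex.I) = (starRingEnd ℂ) (Complex.exp ((t : ℂ) * Complex.I)) := by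
  rw [← Complex.exp_conj, map_mul, Complex.conj_ofReal, Complex.conj_I]
  push_cast
  ring_nf

/-- kernel: **every site of a nearest-neighbour contour is within its length of the initial point** (sup torus distance; one step moves
the distance by `≤ 1`). [cite: Balaban1983RegularityDecay, p.572 «an arbitrary contour Γ in the lattice»] -/
theorem T_le_length_of_isSChain : ∀ (x : Balaban1983to89.Site P 0) (l : List (Balaban1983to89.Site P 0)), IsSChain x l →
    ∀ z ∈ x :: l, B5Ineq137Torus.T P 0 x z ≤ l.length
  | x, [], _, z, hz => by
    simp only [List.mem_cons, List.not_mem_nil, or_false] at hz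
    rw [hz, B5Ineq137Torus.T_self, List.length_nil, Nat.cast_zero]
  | x, y :: l, hch, z, hz => by
    have hxy : B5Ineq137Torus.T P 0 x y ≤ 1 := by
      obtain ⟨μ, h | h⟩ := hch.1
      · rw [h]; exact T_shift_le_one x μ
      · rw [h, B5Ineq137Torus.T_symm]; exact T_shift_le_one y μ
    rcases List.mem_cons.1 hz with hz | hz
    · rw [hz, B5Ineq137Torus.T_self]; positivity
    · have ih := T_le_length_of_isSChain y l hch.2 z hz
      have ht := B5Ineq137Torus.T_triangle P 0 x y z
      rw [List.length_cons]; push_cast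
      linarith

/-- **THE TRANSPORT `U(A(Γ))` TELESCOPED ALONG THE CONTOUR AT THE NON-FLAT FIELD `u = e^{ieεA}`**: if `‖(D_uφ)(⟨z, ν⟩)‖ ≤ B` at every site `z`
of the contour `Γ = (x, l)` and every direction `ν`, then `‖U(A(Γ))φ(x′) − φ(x)‖ ≤ ε·|Γ|·B`, `x′` the end point — bond by bond,
`U(A(x, y :: l)) = e^{ieεA(x,y)}U(A(y, l))` (`holA_cons`), a forward step costing `‖u_bφ(b₊) − φ(b₋)‖ = ε‖(D_uφ)(b)‖`, a backward step the
same (`|u_b| = 1`, «A_{b̄} = −A_b»); more than two sites per direction. [cite: Balaban1983RegularityDecay, (1.4) p.572, (1.9) p.573] -/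
theorem norm_holA_mul_sub_le (hS : 2 < P.sitesPerDir 0) (e : ℝ) (A : PBond P 0 → ℝ) (φ : Balaban1983to89.Site P 0 → ℂ) {B : ℝ}
    (hB0 : 0 ≤ B) :
    ∀ (x : Balaban1983to89.Site P 0) (l : List (Balaban1983to89.Site P 0)), IsSChain x l →
      (∀ z ∈ x :: l, ∀ ν : Fin P.d, ‖covD P.eps⁻¹ (cfg (expGauge P e A)) φ ⟨z, ν⟩‖ ≤ B) →
      ‖holA e A x l * φ (pathEnd x l) - φ x‖ ≤ P.eps * l.length * B
  | x, [], _, _ => by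
    rw [holA_nil, one_mul]
    simp [pathEnd]
  | x, y :: l, hch, hB => by
    have heps : 0 < P.eps := P.eps_pos
    have ih := norm_holA_mul_sub_le hS e A φ hB0 y l hch.2 (fun z hz ν => hB z (List.mem_cons_of_mem x hz) ν)
    rw [holA_cons]
    set E : ℂ := Complex.exp (((P.eps * e * bondSum A x y : ℝ) : ℂ) * Complex.I) with hEdef
    have hE1 : ‖E‖ = 1 := by rw [hEdef, Complex.norm_exp_ofReal_mul_I]
    have hstep : ‖E * φ y - φ x‖ ≤ P.eps * B := by
      obtain ⟨ν, h | h⟩ := hch.1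
      · -- forward step `y = x + e_ν`
        have hE : E = toC (expGauge P e A ⟨x, ν⟩) := by rw [hEdef, h, bondSum_shift hS, toC_expGauge]
        rw [hE, h, norm_step_forward]
        exact mul_le_mul_of_nonneg_left (hB x (by simp) ν) heps.le
      · -- backward step `x = y + e_ν`
        have hE : E = (starRingEnd ℂ) (toC (expGauge P e A ⟨y, ν⟩)) := by
          rw [hEdef, h, bondSum_unshift hS, toC_expGauge, ← exp_neg_mul_I]
          congr 2; push_cast; ring
        rw [hE, h, norm_step_backward]
        exact mul_le_mul_of_nonneg_left (hB y (by simp) ν) heps.le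
    rw [show E * holA e A y l * φ (pathEnd x (y :: l)) - φ x = E * (holA e A y l * φ (pathEnd y l) - φ y) + (E * φ y - φ x) by
      simp only [pathEnd]; ring]
    calc ‖E * (holA e A y l * φ (pathEnd y l) - φ y) + (E * φ y - φ x)‖
        ≤ ‖E * (holA e A y l * φ (pathEnd y l) - φ y)‖ + ‖E * φ y - φ x‖ := norm_add_le _ _
      _ ≤ P.eps * l.length * B + P.eps * B := by
          rw [norm_mul, hE1, one_mul]; exact add_le_add ih hstep
      _ = P.eps * (y :: l).length * B := by rw [List.length_cons]; push_cast; ring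

end Transport

/-! ## §2 The covariant-derivative analogue of (2.30) at a (2.23)-regular background for a GENERIC Lipschitz cut-off (far pairs) -/

section DerivLipschitz

open BIJ88NeumannPropagatorFlatClose231 (norm_rowSource_le rowSource_ne_zero abs_lam_le_one)
open BIJ88LocDeriv230FlatTorus (covD_gLocT_apply)
open BIJ88LocDeriv230ZetaPiFlatTorus (norm_rowSource_sub_le_of_lipschitz)
open BIJ85NeumannPropagatorRegularDeriv (input110_deriv_regular_deep)
open BIJ88Close231RegularTorusCwt (bbHull bbHull_bigBlock cubeFamB deepRows mem_deepRows rowMargin rowHyp_ii_hull inputs_regular)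

/-- kernel: a deeper chart margin implies a shallower one. [folklore] -/
private theorem depth_mono (hPd : P.d = d + 1) {n : ℕ} {c M0 : Fin (d + 1) → ℕ} {D D' : ℝ} (hDD : D ≤ D')
    {x : Balaban1983to89.Site P 0}
    (hdeep : ∀ i, D' ≤ (boxCoord hPd n c x i : ℝ) ∧ (boxCoord hPd n c x i : ℝ) + D' ≤ (n * M0 i : ℕ) - 1) :
    ∀ i, D ≤ (boxCoord hPd n c x i : ℝ) ∧ (boxCoord hPd n c x i : ℝ) + D ≤ (n * M0 i : ℕ) - 1 :=
  fun i => ⟨hDD.trans (hdeep i).1, by linarith [(hdeep i).2]⟩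

/-- kernel: `e^{−δ'E} ≤ e^{−δE}` for `δ ≤ δ'`, `E ≥ 0`. [folklore] -/
private theorem exp_le_exp_of_rate {δ δ' E : ℝ} (hδ : δ ≤ δ') (hE : 0 ≤ E) : Real.exp (-(δ' * E)) ≤ Real.exp (-(δ * E)) :=
  Real.exp_le_exp.2 (neg_le_neg (mul_le_mul_of_nonneg_right hδ hE))

/-- **THE COVARIANT-DERIVATIVE ANALOGUE OF (2.30) AT A (2.23)-REGULAR NON-FLAT BACKGROUND `u = e^{ieεA}`, FOR THE PRINTED LOCALIZATION DATA
WITH BIG-BLOCK CUBES AND A GENERIC LIPSCHITZ CUT-OFF** (p. 263: *"Bounds analogous to (2.30), (2.31) hold for covariant derivatives … of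
G_{k,loc}(u) of order less than two"*; the cut-off `ζ″` of (2.29) *"a smooth function of x₁ − x₂"* enters only through `|ζ″| ≤ 1`, `ζ″ = 0`
beyond `R₀` and a one-step modulus `K₁/(R₀ − R₁)` in the output point — r18 gen 24's `BIJ88Close231RegularTorusCwt.deriv230_regular_cwt`
(p13's cut-off of record) VERBATIM with the cut-off abstracted, p29's `norm_rowSource_sub_le_of_lipschitz` for the difference sources).
`∃ s₀ ∀ s ≥ s₀ ∃ c₀ e₁ > 0` (from `(d, L, a, e, c, β, K₁, s)`) such that on every torus of the series, at every level `1 ≤ k ≤ K`,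
`k + s ≤ m + K`, `3L^kL^s ≤ |T^{(0)}|`, for every `A` (2.23)-regular on `T^{(0)}` (`0 < e_k ≤ e₁`), every reference box `Ω₀` (torus gap `≥ R`),
grid spacing `s_g ≥ 1`, half-width `W ≥ 2s_g/3 + R₀/2 + R`, radii `R > rowMargin + 1`, `0 ≤ R₁ < R₀`, every such cut-off `ζ″`, every bond
`⟨x, x+e_μ⟩` with both endpoints in `Ω₀` at chart depth `≥ R₀ + R`, and every `f` with `‖f‖_∞ ≤ F` supported at sup-torus distance `≥ D ≥ 0`
from `x`: `‖D_u(G_{k,loc}(u)f)(⟨x,μ⟩)‖ ≤ (L^kε)·c₀·m·(1 + L^k((R₀−R₁)⁻¹ + s_g⁻¹))·e^{−δ₀D/L^k}·F`, `δ₀ = 1/(8L^s)`,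
`m = (⌊(L^k−1+R₀)/s_g⌋+3)^{d+1}`. [cite: BalabanImbrieJaffe1988, (2.30) p.263] -/
theorem deriv230_regular_of_lipschitz (d L : ℕ) (hL : 2 ≤ L) {a : ℝ} (ha : 0 < a) (e creg β : ℝ) (hcreg : 0 ≤ creg) (hβ : 0 < β)
    {K₁ : ℝ} (hK₁ : 0 ≤ K₁) :
    ∃ s₀ : ℕ, ∀ s : ℕ, s₀ ≤ s → ∃ c₀ e₁ : ℝ, 0 < c₀ ∧ 0 < e₁ ∧
      ∀ (P : Params) (hPd : P.d = d + 1), P.L = L → ∀ (k : ℕ), 1 ≤ k → k ≤ P.K → k + s ≤ P.m + P.K →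
      3 * (L ^ k * L ^ s) ≤ P.sitesPerDir 0 →
      ∀ (A : PBond P 0 → ℝ) (ec : ℝ), 0 < ec → ec ≤ e₁ →
      (∀ (z : Balaban1983to89.Site P 0) (μ ν : Fin P.d),
          P.spacing k * |e| / ec * |A ⟨z.shift μ, ν⟩ - A ⟨z, ν⟩| ≤ creg * ec ^ (β - 1) / (L : ℝ) ^ k) →
      ∀ (c M0 : Fin (d + 1) → ℕ), (∀ i, c i * P.L ^ k + P.L ^ k * M0 i ≤ P.sitesPerDir 0) → (∀ i, P.L ^ k * M0 i < P.sitesPerDir 0) →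
      ∀ (sg W : ℕ), 1 ≤ sg → ∀ (R R₀ R₁ : ℝ), ((rowMargin L (d + 1) k s : ℕ) : ℝ) + 1 < R → 0 ≤ R₁ → R₁ < R₀ →
        2 * (sg : ℝ) / 3 + R₀ / 2 + R ≤ W → (∀ i, ((P.L ^ k * M0 i : ℕ) : ℝ) + R ≤ P.sitesPerDir 0) →
      ∀ (ζ : Balaban1983to89.Site P 0 → Balaban1983to89.Site P 0 → ℝ), (∀ x y, |ζ x y| ≤ 1) →
        (∀ x y, R₀ ≤ B5Ineq137Torus.T P 0 x y → ζ x y = 0) →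
        (∀ (x y : Balaban1983to89.Site P 0) (ν : Fin P.d), |ζ (x.shift ν) y - ζ x y| ≤ K₁ / (R₀ - R₁)) →
      ∀ (x : Balaban1983to89.Site P 0) (μ : Fin P.d),
        x ∈ (cubeT hPd (P.L ^ k) c fun i => P.L ^ k * M0 i) →
        (∀ i, R₀ + R ≤ (boxCoord hPd (P.L ^ k) c x i : ℝ) ∧ (boxCoord hPd (P.L ^ k) c x i : ℝ) + (R₀ + R) ≤ (P.L ^ k * M0 i : ℕ) - 1) →
        x.shift μ ∈ (cubeT hPd (P.L ^ k) c fun i => P.L ^ k * M0 i) →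
        (∀ i, R₀ + R ≤ (boxCoord hPd (P.L ^ k) c (x.shift μ) i : ℝ) ∧
          (boxCoord hPd (P.L ^ k) c (x.shift μ) i : ℝ) + (R₀ + R) ≤ (P.L ^ k * M0 i : ℕ) - 1) →
      ∀ (f : Balaban1983to89.Site P 0 → ℂ) (F D : ℝ), (∀ y, ‖f y‖ ≤ F) → 0 ≤ D → (∀ y, f y ≠ 0 → D ≤ B5Ineq137Torus.T P 0 x y) →
        ‖covD P.eps⁻¹ (cfg (expGauge P e A))
            (gLocT (B1RG242Torus.α P a k * (P.L : ℝ) ^ (k * P.d)) P.eps⁻¹ (expGauge P e A) k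
              (cubeFamB hPd (P.L ^ k) c M0 sg W (L ^ k * L ^ s)) (lamFam hPd (P.L ^ k) c M0 sg)
              ζ *ᵥ f) ⟨x, μ⟩‖ ≤
          P.spacing k * (c₀ * (((⌊(((P.L : ℝ) ^ k) - 1 + R₀) / sg⌋₊ : ℝ) + 3) ^ (d + 1)) *
            (1 + (P.L : ℝ) ^ k * ((R₀ - R₁)⁻¹ + (sg : ℝ)⁻¹)) * Real.exp (-(1 / (8 * (L : ℝ) ^ s) * (((P.L : ℝ) ^ k)⁻¹ * D))) * F) := by
  obtain ⟨s₁, H1⟩ := input110_deriv_regular_deep (d + 1) L (Nat.succ_pos d) hL ha e creg β hcreg hβ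
  obtain ⟨s₂, H2⟩ := inputs_regular (d + 1) L (Nat.succ_pos d) hL ha e creg β hcreg hβ
  set Λ₀ : ℝ := max K₁ (3 * Real.pi * (d + 1 : ℕ) / 2) with hΛ₀def
  have hΛ₀0 : 0 ≤ Λ₀ := hK₁.trans (le_max_left _ _)
  refine ⟨max s₁ s₂, fun s hs => ?_⟩
  have hs₁ : s₁ ≤ s := (le_max_left _ _).trans hs
  have hs₂ : s₂ ≤ s := (le_max_right _ _).trans hs
  obtain ⟨c₁, e₁, hc₁, he₁, G1⟩ := H1 s hs₁
  obtain ⟨c₂, e₂, hc₂, he₂, G2⟩ := H2 s hs₂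
  set C : ℝ := max c₁ (2 * c₂ * Λ₀ + 1) with hCdef
  have hC1 : c₁ ≤ C := le_max_left _ _
  have hC2 : 2 * c₂ * Λ₀ + 1 ≤ C := le_max_right _ _
  have hC0 : 0 ≤ C := hc₁.le.trans hC1
  refine ⟨C, min e₁ e₂, lt_of_lt_of_le hc₁ hC1, lt_min he₁ he₂, ?_⟩
  intro P hPd hPL k hk1 hkK hks hsize A ec hec hece hreg c M0 hfit0 hN0 sg W hsg R R₀ R₁ hRm hR₁ hR10 hW hgap ζ hζabs hζ0 hζ1 x μ hx
    hdeep hxe hdeepe f F D hF hD hsupp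
  obtain ⟨-, I2, -⟩ := G2 P hPd hPL hk1 hkK hks hsize A hec (hece.trans (min_le_right _ _)) hreg
  have hece₁ : ec ≤ e₁ := hece.trans (min_le_left _ _)
  have hn : 1 ≤ P.L ^ k := Nat.one_le_pow _ _ P.L_pos
  have hk : 0 + k ≤ P.m + P.K := by omega
  have hρR : ((rowMargin L (d + 1) k s : ℕ) : ℝ) < R := by linarith
  have hR1 : 1 < R := by
    have : (0 : ℝ) ≤ ((rowMargin L (d + 1) k s : ℕ) : ℝ) := Nat.cast_nonneg _
    linarith
  have hR0 : 0 ≤ R := zero_le_one.trans hR1.le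
  have hR₀ : 0 ≤ R₀ := hR₁.trans hR10.le
  have hs0 : 0 < sg := hsg
  have hsr : (0 : ℝ) < sg := by exact_mod_cast hs0
  have hgap' : 0 < R₀ - R₁ := sub_pos.2 hR10
  have hLr : (0 : ℝ) < L := by exact_mod_cast (show 0 < L by omega)
  have hLs : (0 : ℝ) < (L : ℝ) ^ s := pow_pos hLr s
  have hLpos : (0 : ℝ) < P.L := P.cast_L_pos
  have hLk : (0 : ℝ) < (P.L : ℝ) ^ k := pow_pos hLpos _
  have hε : 0 < ((P.L : ℝ) ^ k)⁻¹ := inv_pos.mpr hLk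
  have hF0 : 0 ≤ F := (norm_nonneg _).trans (hF x)
  have hsp0 : 0 < P.spacing k := P.spacing_pos k
  have heps : 0 < P.eps := P.eps_pos
  have hdeep₀ := depth_mono hPd (show R₀ ≤ R₀ + R by linarith) hdeep
  have hdeepe₀ := depth_mono hPd (show R₀ ≤ R₀ + R by linarith) hdeepe
  -- the rate
  set δ : ℝ := 1 / (8 * (L : ℝ) ^ s) with hδdef
  have hδ0 : 0 < δ := by positivity
  have hδ4 : δ ≤ 1 / (4 * (L : ℝ) ^ s) := one_div_le_one_div_of_le (by positivity) (by nlinarith)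
  -- abbreviations
  set A' : ℝ := B1RG242Torus.α P a k * (P.L : ℝ) ^ (k * P.d) with hA'def
  set U : GaugeField P 0 U1 := expGauge P e A with hUdef
  have hK₁' : 0 ≤ K₁ / (R₀ - R₁) := div_nonneg hK₁ hgap'.le
  set x' := x.shift μ with hx'def
  set cubeB := cubeFamB hPd (P.L ^ k) c M0 sg W (L ^ k * L ^ s) with hcubeBdef
  set m : ℝ := ((⌊(((P.L : ℝ) ^ k) - 1 + R₀) / sg⌋₊ : ℝ) + 3) ^ (d + 1) with hmdef
  have hm0 : 0 ≤ m := by rw [hmdef]; positivity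
  set E : ℝ := Real.exp (-(δ * (((P.L : ℝ) ^ k)⁻¹ * D))) with hEdef
  have hE0 : 0 < E := Real.exp_pos _
  have hεD : 0 ≤ ((P.L : ℝ) ^ k)⁻¹ * D := mul_nonneg hε.le hD
  have hE1 : Real.exp (-(1 / (4 * (L : ℝ) ^ s) * (((P.L : ℝ) ^ k)⁻¹ * D))) ≤ E := exp_le_exp_of_rate hδ4 hεD
  -- the sources
  set g' : ↥(labels (P.L ^ k) M0 sg) → Balaban1983to89.Site P 0 → ℂ :=
    fun α y => (ζ x' y : ℂ) * (lamFam hPd (P.L ^ k) c M0 sg α x' y : ℂ) * f y with hg'def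
  set dg : ↥(labels (P.L ^ k) M0 sg) → Balaban1983to89.Site P 0 → ℂ :=
    fun α y => ((ζ x' y : ℂ) * (lamFam hPd (P.L ^ k) c M0 sg α x' y : ℂ) - (ζ x y : ℂ) * (lamFam hPd (P.L ^ k) c M0 sg α x y : ℂ)) * f y
    with hdgdef
  -- the bond identity (p29)
  have hid : covD P.eps⁻¹ (cfg U) (gLocT A' P.eps⁻¹ U k cubeB (lamFam hPd (P.L ^ k) c M0 sg) ζ *ᵥ f) ⟨x, μ⟩ =
      ∑ α, covD P.eps⁻¹ (cfg U) (gBox A' P.eps⁻¹ U k (cubeB α) *ᵥ g' α) ⟨x, μ⟩ +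
      ∑ α, ((P.eps⁻¹ : ℝ) : ℂ) * (gBox A' P.eps⁻¹ U k (cubeB α) *ᵥ dg α) x :=
    covD_gLocT_apply P.eps⁻¹ (cfg U) A' P.eps⁻¹ U k cubeB (lamFam hPd (P.L ^ k) c M0 sg) ζ f ⟨x, μ⟩
  rw [hid]
  -- the active-label sets of the two endpoints
  set Sx : Finset ↥(labels (P.L ^ k) M0 sg) := (activeLabels hPd (P.L ^ k) c sg R₀ (blkIter k x)).subtype
    fun α => α ∈ labels (P.L ^ k) M0 sg with hSxdef
  set Sx' : Finset ↥(labels (P.L ^ k) M0 sg) := (activeLabels hPd (P.L ^ k) c sg R₀ (blkIter k x')).subtype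
    fun α => α ∈ labels (P.L ^ k) M0 sg with hSx'def
  have hcardx : (Sx.card : ℝ) ≤ m := by
    have h1 := card_subtype_activeLabels_le (hPd := hPd) (c := c) (M0 := M0) hn hs0 hR₀ (blkIter k x)
    have e1 : (((P.L ^ k : ℕ) : ℕ) : ℝ) = (P.L : ℝ) ^ k := by push_cast; rfl
    rw [hSxdef, hmdef]; rw [e1] at h1; exact h1
  have hcardx' : (Sx'.card : ℝ) ≤ m := by
    have h1 := card_subtype_activeLabels_le (hPd := hPd) (c := c) (M0 := M0) hn hs0 hR₀ (blkIter k x')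
    have e1 : (((P.L ^ k : ℕ) : ℕ) : ℝ) = (P.L : ℝ) ^ k := by push_cast; rfl
    rw [hSx'def, hmdef]; rw [e1] at h1; exact h1
  have hSx : ∀ (α : ↥(labels (P.L ^ k) M0 sg)) (y : Balaban1983to89.Site P 0),
      ζ x y * lamFam hPd (P.L ^ k) c M0 sg α x y ≠ 0 → α ∈ Sx := by
    intro α y hne
    rw [hSxdef, Finset.mem_subtype]
    exact mem_activeLabels_of_ne_zero_of_deep hk hs0 hfit0 hζ0 (mem_blockK.2 rfl) hdeep₀ hne
  have hSx' : ∀ (α : ↥(labels (P.L ^ k) M0 sg)) (y : Balaban1983to89.Site P 0),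
      ζ x' y * lamFam hPd (P.L ^ k) c M0 sg α x' y ≠ 0 → α ∈ Sx' := by
    intro α y hne
    rw [hSx'def, Finset.mem_subtype]
    exact mem_activeLabels_of_ne_zero_of_deep hk hs0 hfit0 hζ0 (mem_blockK.2 rfl) hdeepe₀ hne
  have hcardU : ((Sx ∪ Sx').card : ℝ) ≤ 2 * m := by
    have h1 : ((Sx ∪ Sx').card : ℝ) ≤ (Sx.card : ℝ) + (Sx'.card : ℝ) := by exact_mod_cast Finset.card_union_le _ _
    linarith
  -- the source `x` is `rowMargin`-deep in every hull active at either endpoint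
  have hdeep_x' : ∀ (α : ↥(labels (P.L ^ k) M0 sg)) (y₀ : Balaban1983to89.Site P 0),
      ζ x' y₀ * lamFam hPd (P.L ^ k) c M0 sg α x' y₀ ≠ 0 → x ∈ deepRows ((rowMargin L (d + 1) k s : ℕ) : ℝ) (cubeB α) := by
    intro α y₀ hy₀
    obtain ⟨-, -, hfar⟩ := rowHyp_ii_hull hPd hn hs0 hfit0 hR0 hR₀ hρR hgap hW (L ^ k * L ^ s) hζ0 hxe hdeepe α y₀ hy₀
    refine mem_deepRows.2 fun y hy => ?_
    by_contra hnot
    have h1 := (hfar y hnot).1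
    have h2 := abs_le.1 (abs_T_shift_sub_le x y μ)
    linarith
  have hdeep_x : ∀ (α : ↥(labels (P.L ^ k) M0 sg)) (y₀ : Balaban1983to89.Site P 0),
      ζ x y₀ * lamFam hPd (P.L ^ k) c M0 sg α x y₀ ≠ 0 → x ∈ deepRows ((rowMargin L (d + 1) k s : ℕ) : ℝ) (cubeB α) :=
    fun α y₀ hy₀ => (rowHyp_ii_hull hPd hn hs0 hfit0 hR0 hR₀ hρR hgap hW (L ^ k * L ^ s) hζ0 hx hdeep α y₀ hy₀).1
  have hrow_of_deep : ∀ {α : ↥(labels (P.L ^ k) M0 sg)}, x ∈ deepRows ((rowMargin L (d + 1) k s : ℕ) : ℝ) (cubeB α) →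
      ∀ y, B5Ineq137Torus.T P 0 x y ≤
        ((2 * (5 * (L ^ k * L ^ s) / 8 + L ^ k) + 2 * (L ^ k * L ^ s) * (d + 1 + 1) + 1 : ℕ) : ℝ) → y ∈ cubeB α := by
    intro α hxd y hy
    refine (mem_deepRows.1 hxd) y ?_
    unfold rowMargin
    exact hy
  -- TERM 1: the derivative member of (1.10) for the hulls active at `x'` (r01, regular background, deep rows)
  set B₁ : ℝ := P.spacing k * (c₁ * Real.exp (-(1 / (4 * (L : ℝ) ^ s) * (((P.L : ℝ) ^ k)⁻¹ * D))) * F) with hB₁def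
  have hB₁0 : 0 ≤ B₁ := by positivity
  have hterm1 : ∀ α, ‖covD P.eps⁻¹ (cfg U) (gBox A' P.eps⁻¹ U k (cubeB α) *ᵥ g' α) ⟨x, μ⟩‖ ≤ B₁ := by
    intro α
    by_cases hex : ∃ y, ζ x' y * lamFam hPd (P.L ^ k) c M0 sg α x' y ≠ 0
    · obtain ⟨y₀, hy₀⟩ := hex
      have h1 := G1 P hPd hPL hk1 hkK hks hsize (cubeB α) (bbHull_bigBlock _ _) A hec hece₁ (fun z _ μ' ν => hreg z μ' ν) x
        (hrow_of_deep (hdeep_x' α y₀ hy₀)) (g' α) F D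
        (fun y => norm_rowSource_le (hζabs x' y) (abs_lam_le_one (sum_abs_lamT_le_one hfit0) α x' y) hF y)
        (fun y hy => hsupp y (rowSource_ne_zero hy).2) μ
      have e1 : covD P.eps⁻¹ (cfg U) (gBox A' P.eps⁻¹ U k (cubeB α) *ᵥ g' α) ⟨x, μ⟩ =
          covD P.eps⁻¹ (cfg (expGauge P e A)) (gBox A' P.eps⁻¹ (expGauge P e A) k (cubeB α) *ᵥ g' α) ⟨x, μ⟩ := by rw [hUdef]
      rw [e1]
      exact h1
    · push Not at hex
      have h0 : g' α = 0 := by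
        funext y; rw [hg'def]; dsimp only; rw [← Complex.ofReal_mul, hex y, Complex.ofReal_zero, zero_mul]; rfl
      rw [h0, mulVec_zero]
      simp only [covD, Pi.zero_apply, mul_zero, sub_zero, norm_zero]
      exact hB₁0
  have hzero1 : ∀ α, α ∉ Sx' → covD P.eps⁻¹ (cfg U) (gBox A' P.eps⁻¹ U k (cubeB α) *ᵥ g' α) ⟨x, μ⟩ = 0 := by
    intro α hα
    have h0 : g' α = 0 := by
      funext y
      by_contra hne
      exact hα (hSx' α y (rowSource_ne_zero hne).1)
    rw [h0, mulVec_zero]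
    simp only [covD, Pi.zero_apply, mul_zero, sub_zero]
  have hsum1 : ‖∑ α, covD P.eps⁻¹ (cfg U) (gBox A' P.eps⁻¹ U k (cubeB α) *ᵥ g' α) ⟨x, μ⟩‖ ≤ m * B₁ := by
    rw [← Finset.sum_subset (Finset.subset_univ Sx') (fun α _ hα => hzero1 α hα)]
    calc ‖∑ α ∈ Sx', covD P.eps⁻¹ (cfg U) (gBox A' P.eps⁻¹ U k (cubeB α) *ᵥ g' α) ⟨x, μ⟩‖
        ≤ ∑ α ∈ Sx', ‖covD P.eps⁻¹ (cfg U) (gBox A' P.eps⁻¹ U k (cubeB α) *ᵥ g' α) ⟨x, μ⟩‖ := norm_sum_le _ _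
      _ ≤ ∑ α ∈ Sx', B₁ := Finset.sum_le_sum fun α _ => hterm1 α
      _ = Sx'.card * B₁ := by rw [Finset.sum_const, nsmul_eq_mul]
      _ ≤ m * B₁ := mul_le_mul_of_nonneg_right hcardx' hB₁0
  -- TERM 2: the value member of (1.10) (§3) on the difference sources, for the hulls active at `x` or `x'`
  set Λ : ℝ := K₁ / (R₀ - R₁) + 3 * Real.pi * (d + 1 : ℕ) / (2 * sg) with hΛdef
  have hΛ0 : 0 ≤ Λ := by rw [hΛdef]; positivity
  set B₂ : ℝ := P.spacing k ^ 2 * (c₂ * Real.exp (-(δ * (((P.L : ℝ) ^ k)⁻¹ * D))) * (Λ * F)) with hB₂def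
  have hB₂0 : 0 ≤ B₂ := by positivity
  have hterm2 : ∀ α, ‖(gBox A' P.eps⁻¹ U k (cubeB α) *ᵥ dg α) x‖ ≤ B₂ := by
    intro α
    by_cases hex : ∃ y, dg α y ≠ 0
    · obtain ⟨y₀, hy₀⟩ := hex
      have hact : ζ x' y₀ * lamFam hPd (P.L ^ k) c M0 sg α x' y₀ ≠ 0 ∨ ζ x y₀ * lamFam hPd (P.L ^ k) c M0 sg α x y₀ ≠ 0 := by
        by_contra hno
        rw [not_or, not_not, not_not] at hno
        apply hy₀
        rw [hdgdef]; dsimp only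
        rw [← Complex.ofReal_mul, ← Complex.ofReal_mul, hno.1, hno.2]; simp
      have hxd : x ∈ deepRows ((rowMargin L (d + 1) k s : ℕ) : ℝ) (cubeB α) := by
        rcases hact with h1 | h1
        · exact hdeep_x' α y₀ h1
        · exact hdeep_x α y₀ h1
      have h2 := I2 (cubeB α) (bbHull_bigBlock _ _) x hxd (dg α) (Λ * F) D
        (fun y => norm_rowSource_sub_le_of_lipschitz hPd hs0 hfit0 hN0 hK₁' hζabs (fun y => hζ1 x y μ) α.1 hx hxe hF y)
        hD (fun y hy => hsupp y (right_ne_zero_of_mul hy))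
      have e2 : (gBox A' P.eps⁻¹ U k (cubeB α) *ᵥ dg α) x = (gBox A' P.eps⁻¹ (expGauge P e A) k (cubeB α) *ᵥ dg α) x := by
        rw [hUdef]
      rw [e2]
      exact h2
    · push Not at hex
      have h0 : dg α = 0 := funext hex
      rw [h0, mulVec_zero, Pi.zero_apply, norm_zero]
      exact hB₂0
  have hzero2 : ∀ α, α ∉ Sx ∪ Sx' → (gBox A' P.eps⁻¹ U k (cubeB α) *ᵥ dg α) x = 0 := by
    intro α hα
    rw [Finset.mem_union, not_or] at hα
    have h0 : dg α = 0 := by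
      funext y
      rw [hdgdef]; dsimp only
      have h1 : ζ x' y * lamFam hPd (P.L ^ k) c M0 sg α x' y = 0 := by
        by_contra hne; exact hα.2 (hSx' α y hne)
      have h2 : ζ x y * lamFam hPd (P.L ^ k) c M0 sg α x y = 0 := by
        by_contra hne; exact hα.1 (hSx α y hne)
      rw [← Complex.ofReal_mul, ← Complex.ofReal_mul, h1, h2]; simp
    rw [h0, mulVec_zero, Pi.zero_apply]
  have hsum2 : ‖∑ α, ((P.eps⁻¹ : ℝ) : ℂ) * (gBox A' P.eps⁻¹ U k (cubeB α) *ᵥ dg α) x‖ ≤ P.eps⁻¹ * (2 * m * B₂) := by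
    rw [← Finset.mul_sum, norm_mul, Complex.norm_real, Real.norm_eq_abs, abs_of_pos (inv_pos.mpr heps)]
    refine mul_le_mul_of_nonneg_left ?_ (inv_pos.mpr heps).le
    rw [← Finset.sum_subset (Finset.subset_univ (Sx ∪ Sx')) (fun α _ hα => hzero2 α hα)]
    calc ‖∑ α ∈ Sx ∪ Sx', (gBox A' P.eps⁻¹ U k (cubeB α) *ᵥ dg α) x‖
        ≤ ∑ α ∈ Sx ∪ Sx', ‖(gBox A' P.eps⁻¹ U k (cubeB α) *ᵥ dg α) x‖ := norm_sum_le _ _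
      _ ≤ ∑ α ∈ Sx ∪ Sx', B₂ := Finset.sum_le_sum fun α _ => hterm2 α
      _ = (Sx ∪ Sx').card * B₂ := by rw [Finset.sum_const, nsmul_eq_mul]
      _ ≤ 2 * m * B₂ := mul_le_mul_of_nonneg_right hcardU hB₂0
  -- assembling (verbatim from p29's `deriv230_flat_cwt`)
  have hscale : P.eps⁻¹ * P.spacing k ^ 2 = P.spacing k * (P.L : ℝ) ^ k := by
    rw [Params.spacing]
    field_simp
  have hΛle : Λ ≤ Λ₀ * ((R₀ - R₁)⁻¹ + (sg : ℝ)⁻¹) := by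
    rw [hΛdef, mul_add]
    refine add_le_add ?_ ?_
    · rw [div_eq_mul_inv]
      exact mul_le_mul_of_nonneg_right (le_max_left _ _) (inv_pos.mpr hgap').le
    · have e5 : 3 * Real.pi * (d + 1 : ℕ) / (2 * sg) = (3 * Real.pi * (d + 1 : ℕ) / 2) * (sg : ℝ)⁻¹ := by
        field_simp
      rw [e5]
      exact mul_le_mul_of_nonneg_right (le_max_right _ _) (inv_pos.mpr hsr).le
  have h1 : m * B₁ ≤ P.spacing k * (C * m * 1 * E * F) := by
    have : B₁ ≤ P.spacing k * (C * E * F) := by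
      rw [hB₁def]
      refine mul_le_mul_of_nonneg_left ?_ hsp0.le
      exact mul_le_mul_of_nonneg_right (mul_le_mul hC1 hE1 (Real.exp_pos _).le hC0) hF0
    calc m * B₁ ≤ m * (P.spacing k * (C * E * F)) := mul_le_mul_of_nonneg_left this hm0
      _ = P.spacing k * (C * m * 1 * E * F) := by ring
  have h2 : P.eps⁻¹ * (2 * m * B₂) ≤ P.spacing k * (C * m * ((P.L : ℝ) ^ k * ((R₀ - R₁)⁻¹ + (sg : ℝ)⁻¹)) * E * F) := by
    have e6 : P.eps⁻¹ * (2 * m * B₂) =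
        P.spacing k * ((2 * c₂ * Λ) * m * (P.L : ℝ) ^ k * Real.exp (-(δ * (((P.L : ℝ) ^ k)⁻¹ * D))) * F) := by
      rw [hB₂def]
      have : P.eps⁻¹ * (2 * m * (P.spacing k ^ 2 * (c₂ * Real.exp (-(δ * (((P.L : ℝ) ^ k)⁻¹ * D))) * (Λ * F)))) =
          (P.eps⁻¹ * P.spacing k ^ 2) * (2 * c₂ * Λ * m * Real.exp (-(δ * (((P.L : ℝ) ^ k)⁻¹ * D))) * F) := by ring
      rw [this, hscale]; ring
    rw [e6]
    refine mul_le_mul_of_nonneg_left ?_ hsp0.le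
    have hcoef : 2 * c₂ * Λ * m * (P.L : ℝ) ^ k ≤ C * m * ((P.L : ℝ) ^ k * ((R₀ - R₁)⁻¹ + (sg : ℝ)⁻¹)) := by
      have h3 : 2 * c₂ * Λ ≤ C * ((R₀ - R₁)⁻¹ + (sg : ℝ)⁻¹) := by
        calc 2 * c₂ * Λ ≤ 2 * c₂ * (Λ₀ * ((R₀ - R₁)⁻¹ + (sg : ℝ)⁻¹)) := mul_le_mul_of_nonneg_left hΛle (by positivity)
          _ = (2 * c₂ * Λ₀) * ((R₀ - R₁)⁻¹ + (sg : ℝ)⁻¹) := by ring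
          _ ≤ C * ((R₀ - R₁)⁻¹ + (sg : ℝ)⁻¹) :=
              mul_le_mul_of_nonneg_right (by linarith) (by positivity)
      calc 2 * c₂ * Λ * m * (P.L : ℝ) ^ k = (2 * c₂ * Λ) * (m * (P.L : ℝ) ^ k) := by ring
        _ ≤ (C * ((R₀ - R₁)⁻¹ + (sg : ℝ)⁻¹)) * (m * (P.L : ℝ) ^ k) := mul_le_mul_of_nonneg_right h3 (by positivity)
        _ = C * m * ((P.L : ℝ) ^ k * ((R₀ - R₁)⁻¹ + (sg : ℝ)⁻¹)) := by ring
    exact mul_le_mul_of_nonneg_right (mul_le_mul hcoef le_rfl (Real.exp_pos _).le (by positivity)) hF0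
  refine ((norm_add_le _ _).trans (add_le_add hsum1 hsum2)).trans ?_
  calc m * B₁ + P.eps⁻¹ * (2 * m * B₂)
      ≤ P.spacing k * (C * m * 1 * E * F) + P.spacing k * (C * m * ((P.L : ℝ) ^ k * ((R₀ - R₁)⁻¹ + (sg : ℝ)⁻¹)) * E * F) :=
        add_le_add h1 h2
    _ = P.spacing k * (C * m * (1 + (P.L : ℝ) ^ k * ((R₀ - R₁)⁻¹ + (sg : ℝ)⁻¹)) * E * F) := by ring

end DerivLipschitz

/-! ## §3 The Hölder member of order `1 + θ` of (2.30) at a (2.23)-regular background for a SMOOTH cut-off -/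

section DerivHolder

open BIJ88NeumannPropagatorFlatClose231 (norm_rowSource_le rowSource_ne_zero abs_lam_le_one)
open BIJ88LocDeriv230FlatTorus (covD_gLocT_apply)
open BIJ88LocDeriv230ZetaPiFlatTorus (norm_rowSource_sub_le_of_lipschitz)
open BIJ88LocDerivHolder230FlatTorus (abs_weight_shift_sub_le_of_hull abs_weight_bondDiff_sub_le_of_hull)
open BIJ85NeumannPropagatorRegularDeriv (input110_deriv_regular_deep)
open BIJ88Close231RegularTorusCwt (bbHull bbHull_bigBlock cubeFamB deepRows mem_deepRows rowMargin rowHyp_ii_hull inputs_regular)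

/-- kernel: for `1 ≤ t` and `θ ≤ 1`, `t^θ ≤ t`. [folklore] -/
private theorem rpow_le_self_of_one_le' {t θ : ℝ} (ht : 1 ≤ t) (hθ : θ ≤ 1) : t ^ θ ≤ t := by
  have h := Real.rpow_le_rpow_of_exponent_le ht hθ
  rwa [Real.rpow_one] at h

/-- kernel: `D_u` is linear in the function — `D_u(Gf)(b) − D_u(Gg)(b) = D_u(G(f − g))(b)`. [cite: BalabanImbrieJaffe1988, (3.2) p.265] -/
private theorem covD_mulVec_sub (c' : ℝ) (u : PBond P 0 → ℂ) (G : Matrix (Balaban1983to89.Site P 0) (Balaban1983to89.Site P 0) ℂ)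
    (f g : Balaban1983to89.Site P 0 → ℂ) (b : PBond P 0) :
    covD c' u (G *ᵥ f) b - covD c' u (G *ᵥ g) b = covD c' u (G *ᵥ (f - g)) b := by
  simp only [covD, Matrix.mulVec_sub, Pi.sub_apply]
  ring

/-- kernel: `D_u` of the zero function vanishes. [cite: BalabanImbrieJaffe1988, (3.2) p.265] -/
private theorem covD_zero (c' : ℝ) (u : PBond P 0 → ℂ) (b : PBond P 0) : covD c' u (0 : Balaban1983to89.Site P 0 → ℂ) b = 0 := by
  simp only [covD, Pi.zero_apply, mul_zero, sub_zero]

/-- kernel: a deeper chart margin implies a shallower one. [folklore] -/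
private theorem depth_mono' (hPd : P.d = d + 1) {n : ℕ} {c M0 : Fin (d + 1) → ℕ} {D D' : ℝ} (hDD : D ≤ D')
    {x : Balaban1983to89.Site P 0}
    (hdeep : ∀ i, D' ≤ (boxCoord hPd n c x i : ℝ) ∧ (boxCoord hPd n c x i : ℝ) + D' ≤ (n * M0 i : ℕ) - 1) :
    ∀ i, D ≤ (boxCoord hPd n c x i : ℝ) ∧ (boxCoord hPd n c x i : ℝ) + D ≤ (n * M0 i : ℕ) - 1 :=
  fun i => ⟨hDD.trans (hdeep i).1, by linarith [(hdeep i).2]⟩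

set_option maxHeartbeats 800000 in
/-- **THE HÖLDER MEMBER OF ORDER `1 + θ` (`0 ≤ θ < 1`) OF (2.30) AT A (2.23)-REGULAR NON-FLAT BACKGROUND `u = e^{ieεA}`, FOR THE PRINTED
LOCALIZATION DATA WITH BIG-BLOCK CUBES AND A SMOOTH CUT-OFF, ALONG ANY NEAREST-NEIGHBOUR CONTOUR OF LENGTH `≤ (d+1)|x₁ − x₂|_T`** (p. 263:
*"Bounds analogous to (2.30), (2.31) hold for covariant derivatives and Holder derivatives of G_{k,loc}(u) of order less than two"* — the member
of top order, [6] (1.9) for `G_{k,loc}(u)`: *"|x − x′|^{−α}|U(A(Γ_{x,x′}))(D^η_{A,μ}G f)(x′) − (D^η_{A,μ}G f)(x)| ≤ c₀exp(−δ₀ dist({x, x′}, supp f))‖f‖_∞"*).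
For `0 ≤ θ < 1` and moduli `K₁, K₂ ≥ 0`: `∃ s₀ ∀ s ≥ s₀ ∃ c₀ e₁ > 0` (from `(d, L, a, e, c, β, θ, K₁, K₂, s)` only) such that on every torus of the
series (`P.d = d+1`, `P.L = L ≥ 2`), at every level `1 ≤ k ≤ K` with `k + s ≤ m + K`, `3L^kL^s ≤ |T^{(0)}|`, for every `A` (2.23)-regular on
`T^{(0)}` (`0 < e_k ≤ e₁`), `u = e^{ieεA}`, every reference no-wrap box `Ω₀ = c·L^k + Π_i[0, L^kM₀_i)` shorter than the torus with torus gap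
`≥ R`, grid spacing `s_g ≥ 1`, half-width `W ≥ 2s_g/3 + R₀/2 + R`, radii `R > rowMargin + (d+2)L^k + 1`, `0 ≤ R₁ < R₀`, EVERY real cut-off `ζ″`
with `|ζ″| ≤ 1`, `ζ″(x,y) = 0` for `|x − y|_T ≥ R₀`, first lattice differences in `x` bounded by `K₁/(R₀−R₁)` and mixed second ones by
`K₂/(R₀−R₁)²`, every direction `μ`, all bonds `⟨x₁, x₁+e_μ⟩`, `⟨x₂, x₂+e_μ⟩` with their four end points in `Ω₀` at chart depth `≥ R₀ + R`,
every nearest-neighbour contour `Γ = (x₁, l)` ending at `x₂` with `|Γ| ≤ (d+1)|x₁ − x₂|_T` ([6]: *"Γ_{x,x′} a shortest contour"* is one), and every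
`f` (`‖f‖_∞ ≤ F`) supported at sup-torus distance `≥ D ≥ 0` from `x₁` and from `x₂`:
`(L^k/|x₁ − x₂|_T)^θ·‖U(A(Γ))(D_uG_{k,loc}(u)f)(x₂, μ) − (D_uG_{k,loc}(u)f)(x₁, μ)‖ ≤ (L^kε)·c₀·m·(1 + L^k((R₀−R₁)⁻¹ + s_g⁻¹))²·e^{−δ₀D/L^k}·F`,
`δ₀ = 1/(8L^s)`, `m = (⌊(L^k − 1 + R₀)/s_g⌋ + 3)^{d+1}`, `U(A(Γ)) = holA e A x₁ l`, `G_{k,loc}(u)` built from the big-block hulls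
`bbHull (L^kL^s) □_α` of p29's torus cubes and the weights `λ_α` of (2.27).  MECHANISM (p29 gen 28's four-term split, near pairs
`|x₁ − x₂|_T ≤ L^k`): the bond identity `covD_gLocT_apply` at both bonds and — (A) [7] (1.9) at the regular `u` for each hull active at
`x₂ + e_μ` on its fixed row source (r01's `input19_holder_regular_deep`), (B) the derivative member of [7] (1.10) at `⟨x₁,x₁+e_μ⟩` on the
difference of the row sources of `x₂ + e_μ`, `x₁ + e_μ` (r01's `input110_deriv_regular_deep`; Lipschitz in the chart, p29's
`abs_weight_shift_sub_le_of_hull`), (C) the transported difference of the VALUES of the hull propagators on the bond-difference source of `x₂`,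
telescoped ALONG `Γ` AT THE NON-FLAT `u` (`norm_holA_mul_sub_le`) with (1.10)'s derivative member per bond at the contour sites (all
`rowMargin`-deep: within `(d+1)|x₁ − x₂|_T` of `x₁`), (D) (1.10)'s value member (r18's `inputs_regular`) on the SECOND difference of the row
weights (p29's `abs_weight_bondDiff_sub_le_of_hull`); far pairs: two derivative members (`deriv230_regular_of_lipschitz`), `|U(A(Γ))| = 1`.
[cite: BalabanImbrieJaffe1988, (2.30) p.263] [cite: Balaban1983RegularityDecay, (1.9) p.573] -/
theorem derivHolder230_regular_of_smooth (d L : ℕ) (hL : 2 ≤ L) {a : ℝ} (ha : 0 < a) (e creg β : ℝ) (hcreg : 0 ≤ creg) (hβ : 0 < β)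
    {θ : ℝ} (hθ0 : 0 ≤ θ) (hθ1 : θ < 1) {K₁ K₂ : ℝ} (hK₁ : 0 ≤ K₁) (hK₂ : 0 ≤ K₂) :
    ∃ s₀ : ℕ, ∀ s : ℕ, s₀ ≤ s → ∃ c₀ e₁ : ℝ, 0 < c₀ ∧ 0 < e₁ ∧
      ∀ (P : Params) (hPd : P.d = d + 1), P.L = L → ∀ (k : ℕ), 1 ≤ k → k ≤ P.K → k + s ≤ P.m + P.K →
      3 * (L ^ k * L ^ s) ≤ P.sitesPerDir 0 →
      ∀ (A : PBond P 0 → ℝ) (ec : ℝ), 0 < ec → ec ≤ e₁ →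
      (∀ (z : Balaban1983to89.Site P 0) (μ ν : Fin P.d),
          P.spacing k * |e| / ec * |A ⟨z.shift μ, ν⟩ - A ⟨z, ν⟩| ≤ creg * ec ^ (β - 1) / (L : ℝ) ^ k) →
      ∀ (c M0 : Fin (d + 1) → ℕ), (∀ i, c i * P.L ^ k + P.L ^ k * M0 i ≤ P.sitesPerDir 0) → (∀ i, P.L ^ k * M0 i < P.sitesPerDir 0) →
      ∀ (sg W : ℕ), 1 ≤ sg → ∀ (R R₀ R₁ : ℝ), ((rowMargin L (d + 1) k s : ℕ) : ℝ) + ((d : ℝ) + 2) * (P.L : ℝ) ^ k + 1 < R → 0 ≤ R₁ → R₁ < R₀ →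
        2 * (sg : ℝ) / 3 + R₀ / 2 + R ≤ W → (∀ i, ((P.L ^ k * M0 i : ℕ) : ℝ) + R ≤ P.sitesPerDir 0) →
      ∀ (ζ : Balaban1983to89.Site P 0 → Balaban1983to89.Site P 0 → ℝ), (∀ x y, |ζ x y| ≤ 1) →
        (∀ x y, R₀ ≤ B5Ineq137Torus.T P 0 x y → ζ x y = 0) →
        (∀ (x y : Balaban1983to89.Site P 0) (ν : Fin P.d), |ζ (x.shift ν) y - ζ x y| ≤ K₁ / (R₀ - R₁)) →
        (∀ (x y : Balaban1983to89.Site P 0) (κ ν : Fin P.d),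
          |ζ ((x.shift ν).shift κ) y - ζ (x.shift ν) y - ζ (x.shift κ) y + ζ x y| ≤ K₂ / (R₀ - R₁) ^ 2) →
      ∀ (x₁ x₂ : Balaban1983to89.Site P 0) (μ : Fin P.d),
        x₁ ∈ (cubeT hPd (P.L ^ k) c fun i => P.L ^ k * M0 i) →
        (∀ i, R₀ + R ≤ (boxCoord hPd (P.L ^ k) c x₁ i : ℝ) ∧ (boxCoord hPd (P.L ^ k) c x₁ i : ℝ) + (R₀ + R) ≤ (P.L ^ k * M0 i : ℕ) - 1) →
        x₁.shift μ ∈ (cubeT hPd (P.L ^ k) c fun i => P.L ^ k * M0 i) →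
        (∀ i, R₀ + R ≤ (boxCoord hPd (P.L ^ k) c (x₁.shift μ) i : ℝ) ∧
          (boxCoord hPd (P.L ^ k) c (x₁.shift μ) i : ℝ) + (R₀ + R) ≤ (P.L ^ k * M0 i : ℕ) - 1) →
        x₂ ∈ (cubeT hPd (P.L ^ k) c fun i => P.L ^ k * M0 i) →
        (∀ i, R₀ + R ≤ (boxCoord hPd (P.L ^ k) c x₂ i : ℝ) ∧ (boxCoord hPd (P.L ^ k) c x₂ i : ℝ) + (R₀ + R) ≤ (P.L ^ k * M0 i : ℕ) - 1) →
        x₂.shift μ ∈ (cubeT hPd (P.L ^ k) c fun i => P.L ^ k * M0 i) →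
        (∀ i, R₀ + R ≤ (boxCoord hPd (P.L ^ k) c (x₂.shift μ) i : ℝ) ∧
          (boxCoord hPd (P.L ^ k) c (x₂.shift μ) i : ℝ) + (R₀ + R) ≤ (P.L ^ k * M0 i : ℕ) - 1) →
      ∀ (l : List (Balaban1983to89.Site P 0)), IsSChain x₁ l → pathEnd x₁ l = x₂ →
        (l.length : ℝ) ≤ ((d : ℝ) + 1) * B5Ineq137Torus.T P 0 x₁ x₂ →
      ∀ (f : Balaban1983to89.Site P 0 → ℂ) (F D : ℝ), (∀ y, ‖f y‖ ≤ F) → 0 ≤ D →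
        (∀ y, f y ≠ 0 → D ≤ B5Ineq137Torus.T P 0 x₁ y) → (∀ y, f y ≠ 0 → D ≤ B5Ineq137Torus.T P 0 x₂ y) →
        ((P.L : ℝ) ^ k / B5Ineq137Torus.T P 0 x₁ x₂) ^ θ *
          ‖holA e A x₁ l *
              covD P.eps⁻¹ (cfg (expGauge P e A))
                (gLocT (B1RG242Torus.α P a k * (P.L : ℝ) ^ (k * P.d)) P.eps⁻¹ (expGauge P e A) k
                  (cubeFamB hPd (P.L ^ k) c M0 sg W (L ^ k * L ^ s)) (lamFam hPd (P.L ^ k) c M0 sg) ζ *ᵥ f) ⟨x₂, μ⟩ -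
            covD P.eps⁻¹ (cfg (expGauge P e A))
                (gLocT (B1RG242Torus.α P a k * (P.L : ℝ) ^ (k * P.d)) P.eps⁻¹ (expGauge P e A) k
                  (cubeFamB hPd (P.L ^ k) c M0 sg W (L ^ k * L ^ s)) (lamFam hPd (P.L ^ k) c M0 sg) ζ *ᵥ f) ⟨x₁, μ⟩‖ ≤
          P.spacing k * (c₀ * (⌊(((P.L : ℝ) ^ k) - 1 + R₀) / sg⌋₊ + 3) ^ (d + 1) *
            (1 + (P.L : ℝ) ^ k * ((R₀ - R₁)⁻¹ + (sg : ℝ)⁻¹)) ^ 2 * Real.exp (-(1 / (8 * (L : ℝ) ^ s) * (((P.L : ℝ) ^ k)⁻¹ * D))) * F) := by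
  obtain ⟨sH, HH0⟩ := input19_holder_regular_deep (d + 1) L (Nat.succ_pos d) hL ha e creg β hcreg hβ
  obtain ⟨s₁, H1⟩ := input110_deriv_regular_deep (d + 1) L (Nat.succ_pos d) hL ha e creg β hcreg hβ
  obtain ⟨s₂, H2⟩ := inputs_regular (d + 1) L (Nat.succ_pos d) hL ha e creg β hcreg hβ
  obtain ⟨s₃, H3⟩ := deriv230_regular_of_lipschitz d L hL ha e creg β hcreg hβ hK₁
  refine ⟨max (max sH s₁) (max s₂ s₃), fun s hs => ?_⟩
  have hsH : sH ≤ s := ((le_max_left _ _).trans (le_max_left _ _)).trans hs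
  have hs₁ : s₁ ≤ s := ((le_max_right _ _).trans (le_max_left _ _)).trans hs
  have hs₂ : s₂ ≤ s := ((le_max_left _ _).trans (le_max_right _ _)).trans hs
  have hs₃ : s₃ ≤ s := ((le_max_right _ _).trans (le_max_right _ _)).trans hs
  obtain ⟨cH, eH, hcH, heH, GH⟩ := HH0 hθ0 hθ1 s hsH
  obtain ⟨c₁, e₁, hc₁, he₁, G1⟩ := H1 s hs₁
  obtain ⟨c₂, e₂, hc₂, he₂, G2⟩ := H2 s hs₂
  obtain ⟨cg, eg, hcg, heg, Hg⟩ := H3 s hs₃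
  -- the rates
  have hLr : (0 : ℝ) < L := by exact_mod_cast (show 0 < L by omega)
  have hLs : (0 : ℝ) < (L : ℝ) ^ s := pow_pos hLr s
  set δ : ℝ := 1 / (8 * (L : ℝ) ^ s) with hδdef
  have hδ0 : 0 < δ := by positivity
  set δ₄ : ℝ := 1 / (4 * (L : ℝ) ^ s) with hδ₄def
  have hδ₄0 : 0 < δ₄ := by positivity
  have hδ4 : δ ≤ δ₄ := one_div_le_one_div_of_le (by positivity) (by nlinarith)
  -- the constants
  set Λ₀ : ℝ := max K₁ (3 * Real.pi * (d + 1 : ℕ) / 2) with hΛ₀def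
  have hΛ₀0 : 0 ≤ Λ₀ := hK₁.trans (le_max_left _ _)
  set Λ₀₂ : ℝ := K₂ + 4 * Real.pi ^ 2 + 3 * Real.pi * (d + 1 : ℕ) * K₁ with hΛ₀₂def
  have hΛ₀₂0 : 0 ≤ Λ₀₂ := by rw [hΛ₀₂def]; positivity
  set CB : ℝ := 2 * ((d : ℝ) + 1) * Λ₀ * c₁ with hCBdef
  set CC : ℝ := 2 * ((d : ℝ) + 1) * Real.exp (((d : ℝ) + 1) * δ₄) * Λ₀ * c₁ with hCCdef
  set CD : ℝ := 4 * ((d : ℝ) + 1) * Λ₀₂ * c₂ with hCDdef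
  have hCB0 : 0 ≤ CB := by rw [hCBdef]; positivity
  have hCC0 : 0 ≤ CC := by rw [hCCdef]; positivity
  have hCD0 : 0 ≤ CD := by rw [hCDdef]; positivity
  set C : ℝ := cH + CB + CC + CD + 2 * cg with hCdef
  have hC0 : 0 < C := by rw [hCdef]; positivity
  refine ⟨C, min (min eH e₁) (min e₂ eg), hC0, lt_min (lt_min heH he₁) (lt_min he₂ heg), ?_⟩
  intro P hPd hPL k hk1 hkK hks hsize A ec hec hece hreg c M0 hfit0 hN0 sg W hsg R R₀ R₁ hR hR₁ hR10 hW hgap ζ hζabs hζ0 hζ1 hζ2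
    x₁ x₂ μ hx₁ hdeep₁ hx₁e hdeep₁e hx₂ hdeep₂ hx₂e hdeep₂e l hch hend hlen f F D hF hD hsupp₁ hsupp₂
  have heceH : ec ≤ eH := hece.trans ((min_le_left _ _).trans (min_le_left _ _))
  have hece₁ : ec ≤ e₁ := hece.trans ((min_le_left _ _).trans (min_le_right _ _))
  have hece₂ : ec ≤ e₂ := hece.trans ((min_le_right _ _).trans (min_le_left _ _))
  have heceg : ec ≤ eg := hece.trans ((min_le_right _ _).trans (min_le_right _ _))
  obtain ⟨-, I2, -⟩ := G2 P hPd hPL hk1 hkK hks hsize A hec hece₂ hreg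
  -- elementary facts
  have hn : 1 ≤ P.L ^ k := Nat.one_le_pow _ _ P.L_pos
  have hk : 0 + k ≤ P.m + P.K := by omega
  have hLpos : (0 : ℝ) < P.L := P.cast_L_pos
  have hLk : (0 : ℝ) < (P.L : ℝ) ^ k := pow_pos hLpos _
  have hLk1 : (1 : ℝ) ≤ (P.L : ℝ) ^ k := by exact_mod_cast hn
  have hLkinv : 0 < ((P.L : ℝ) ^ k)⁻¹ := inv_pos.mpr hLk
  set ρm : ℝ := ((rowMargin L (d + 1) k s : ℕ) : ℝ) with hρmdef
  have hρm0 : 0 ≤ ρm := Nat.cast_nonneg _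
  have hdpos : (0 : ℝ) ≤ (d : ℝ) := Nat.cast_nonneg d
  have hL1 : (P.L : ℝ) ^ k ≤ ((d : ℝ) + 2) * (P.L : ℝ) ^ k := le_mul_of_one_le_left hLk.le (by linarith)
  have hρR : ρm < R := by linarith
  have hRm : ρm + 1 < R := by linarith
  have hR1 : 1 < R := by linarith
  have hR0 : 0 ≤ R := by linarith
  have hR₀ : 0 ≤ R₀ := hR₁.trans hR10.le
  have hs0 : 0 < sg := hsg
  have hsr : (0 : ℝ) < sg := by exact_mod_cast hs0
  have hgap' : 0 < R₀ - R₁ := sub_pos.2 hR10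
  have hF0 : 0 ≤ F := (norm_nonneg _).trans (hF x₁)
  have hsp0 : 0 < P.spacing k := P.spacing_pos k
  have heps : 0 < P.eps := P.eps_pos
  have hK₁' : 0 ≤ K₁ / (R₀ - R₁) := div_nonneg hK₁ hgap'.le
  have hS2 : 2 < P.sitesPerDir 0 := by
    have h1 : 1 ≤ L ^ s := Nat.one_le_pow _ _ (by omega)
    have h2 : 2 ≤ L ^ k := le_trans hL (Nat.le_self_pow (by omega) L)
    have h3 : 3 * (2 * 1) ≤ 3 * (L ^ k * L ^ s) := Nat.mul_le_mul_left 3 (Nat.mul_le_mul h2 h1)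
    omega
  have hdeep₁₀ := depth_mono' hPd (show R₀ ≤ R₀ + R by linarith) hdeep₁
  have hdeep₁e₀ := depth_mono' hPd (show R₀ ≤ R₀ + R by linarith) hdeep₁e
  have hdeep₂₀ := depth_mono' hPd (show R₀ ≤ R₀ + R by linarith) hdeep₂
  have hdeep₂e₀ := depth_mono' hPd (show R₀ ≤ R₀ + R by linarith) hdeep₂e
  -- abbreviations
  set Ω₀ : Finset (Balaban1983to89.Site P 0) := cubeT hPd (P.L ^ k) c fun i => P.L ^ k * M0 i with hΩ₀def
  set A' : ℝ := B1RG242Torus.α P a k * (P.L : ℝ) ^ (k * P.d) with hA'def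
  set U : GaugeField P 0 U1 := expGauge P e A with hUdef
  set cubeB := cubeFamB hPd (P.L ^ k) c M0 sg W (L ^ k * L ^ s) with hcubeBdef
  set x₁' := x₁.shift μ with hx₁'def
  set x₂' := x₂.shift μ with hx₂'def
  set T12 : ℝ := B5Ineq137Torus.T P 0 x₁ x₂ with hT12def
  have hT0 : 0 ≤ T12 := B5Ineq137Torus.T_nonneg P 0 x₁ x₂
  set m : ℝ := ((⌊(((P.L : ℝ) ^ k) - 1 + R₀) / sg⌋₊ : ℝ) + 3) ^ (d + 1) with hmdef
  have hm0 : 0 ≤ m := by rw [hmdef]; positivity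
  set uv : ℝ := (R₀ - R₁)⁻¹ + (sg : ℝ)⁻¹ with huvdef
  have huv0 : 0 ≤ uv := by rw [huvdef]; positivity
  set br : ℝ := 1 + (P.L : ℝ) ^ k * uv with hbrdef
  have hbr1 : 1 ≤ br := by rw [hbrdef]; exact le_add_of_nonneg_right (by positivity)
  have hbr0 : 0 ≤ br := zero_le_one.trans hbr1
  have hbr2 : br ≤ br ^ 2 := by
    calc br = 1 * br := (one_mul _).symm
      _ ≤ br * br := mul_le_mul_of_nonneg_right hbr1 hbr0
      _ = br ^ 2 := (sq br).symm
  have hLuv : (P.L : ℝ) ^ k * uv ≤ br := by rw [hbrdef]; exact le_add_of_nonneg_left zero_le_one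
  set Ex : ℝ := Real.exp (-(δ * (((P.L : ℝ) ^ k)⁻¹ * D))) with hEdef
  have hE0 : 0 < Ex := Real.exp_pos _
  have hεD : 0 ≤ ((P.L : ℝ) ^ k)⁻¹ * D := mul_nonneg hLkinv.le hD
  have hE4 : Real.exp (-(δ₄ * (((P.L : ℝ) ^ k)⁻¹ * D))) ≤ Ex := Real.exp_le_exp.2 (neg_le_neg (mul_le_mul_of_nonneg_right hδ4 hεD))
  -- the weight
  set w : ℝ := ((P.L : ℝ) ^ k / T12) ^ θ with hwdef
  have hw0 : 0 ≤ w := Real.rpow_nonneg (div_nonneg hLk.le hT0) θ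
  -- the transport and its modulus
  set τ : ℂ := holA e A x₁ l with hτdef
  have hτ1 : ‖τ‖ = 1 := norm_holA e A x₁ l
  -- the target, factorised
  have hRHS : P.spacing k * (C * m * br ^ 2 * Ex * F) =
      P.spacing k * (C * (⌊(((P.L : ℝ) ^ k) - 1 + R₀) / sg⌋₊ + 3) ^ (d + 1) *
        (1 + (P.L : ℝ) ^ k * ((R₀ - R₁)⁻¹ + (sg : ℝ)⁻¹)) ^ 2 * Real.exp (-(1 / (8 * (L : ℝ) ^ s) * (((P.L : ℝ) ^ k)⁻¹ * D))) * F) := by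
    rw [hmdef, hbrdef, huvdef, hEdef]
  rw [← hRHS]
  have hRHS0 : 0 ≤ P.spacing k * (C * m * br ^ 2 * Ex * F) := by positivity
  -- coincident points: the contour is empty and the difference vanishes
  by_cases hne : x₂ = x₁
  · have hl0 : l = [] := by
      have h1 : (l.length : ℝ) ≤ 0 := by
        have h0 := hlen
        rw [hT12def, hne, B5Ineq137Torus.T_self, mul_zero] at h0; exact h0
      have h2 : l.length = 0 := by exact_mod_cast le_antisymm h1 (Nat.cast_nonneg _)
      exact List.eq_nil_of_length_eq_zero h2
    have hτ : τ = 1 := by rw [hτdef, hl0, holA_nil]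
    rw [hτ, one_mul, hne, sub_self, norm_zero, mul_zero]
    exact hRHS0
  set X₁ := covD P.eps⁻¹ (cfg U) (gLocT A' P.eps⁻¹ U k cubeB (lamFam hPd (P.L ^ k) c M0 sg) ζ *ᵥ f) ⟨x₁, μ⟩ with hX₁def
  set X₂ := covD P.eps⁻¹ (cfg U) (gLocT A' P.eps⁻¹ U k cubeB (lamFam hPd (P.L ^ k) c M0 sg) ζ *ᵥ f) ⟨x₂, μ⟩ with hX₂def
  by_cases hnear : (P.L : ℝ) ^ k < T12
  · /- FAR PAIRS: two derivative members, `|U(A(Γ))| = 1` -/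
    have hTpos : 0 < T12 := hLk.trans hnear
    have hw1 : w ≤ 1 := by
      refine Real.rpow_le_one (div_nonneg hLk.le hT0) ?_ hθ0
      rw [div_le_one hTpos]; exact hnear.le
    have hg₁ := Hg P hPd hPL k hk1 hkK hks hsize A ec hec heceg hreg c M0 hfit0 hN0 sg W hsg R R₀ R₁ hRm hR₁ hR10 hW hgap ζ hζabs hζ0 hζ1
      x₁ μ hx₁ hdeep₁ hx₁e hdeep₁e f F D hF hD hsupp₁
    have hg₂ := Hg P hPd hPL k hk1 hkK hks hsize A ec hec heceg hreg c M0 hfit0 hN0 sg W hsg R R₀ R₁ hRm hR₁ hR10 hW hgap ζ hζabs hζ0 hζ1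
      x₂ μ hx₂ hdeep₂ hx₂e hdeep₂e f F D hF hD hsupp₂
    have hBg : ∀ X : ℝ, X ≤ P.spacing k * (cg * (((⌊(((P.L : ℝ) ^ k) - 1 + R₀) / sg⌋₊ : ℝ) + 3) ^ (d + 1)) *
        (1 + (P.L : ℝ) ^ k * ((R₀ - R₁)⁻¹ + (sg : ℝ)⁻¹)) * Real.exp (-(1 / (8 * (L : ℝ) ^ s) * (((P.L : ℝ) ^ k)⁻¹ * D))) * F) →
        X ≤ P.spacing k * (cg * m * br * Ex * F) := fun X hX => by
      rw [← hmdef, ← huvdef, ← hbrdef, ← hδdef, ← hEdef] at hX; exact hX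
    have h1 : ‖X₁‖ ≤ P.spacing k * (cg * m * br * Ex * F) := hBg _ hg₁
    have h2 : ‖X₂‖ ≤ P.spacing k * (cg * m * br * Ex * F) := hBg _ hg₂
    have hτX : ‖τ * X₂‖ = ‖X₂‖ := by rw [norm_mul, hτ1, one_mul]
    calc w * ‖τ * X₂ - X₁‖ ≤ 1 * ‖τ * X₂ - X₁‖ := mul_le_mul_of_nonneg_right hw1 (norm_nonneg _)
      _ ≤ ‖τ * X₂‖ + ‖X₁‖ := by rw [one_mul]; exact norm_sub_le _ _
      _ ≤ P.spacing k * (cg * m * br * Ex * F) + P.spacing k * (cg * m * br * Ex * F) := by rw [hτX]; exact add_le_add h2 h1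
      _ = P.spacing k * ((2 * cg) * m * br * Ex * F) := by ring
      _ ≤ P.spacing k * (C * m * br ^ 2 * Ex * F) := by
          refine mul_le_mul_of_nonneg_left ?_ hsp0.le
          have hc : 2 * cg ≤ C := by rw [hCdef]; linarith only [hcH.le, hCB0, hCC0, hCD0]
          have h3 : (2 * cg) * m * br ≤ C * m * br ^ 2 := mul_le_mul (mul_le_mul_of_nonneg_right hc hm0) hbr2 hbr0 (by positivity)
          exact mul_le_mul_of_nonneg_right (mul_le_mul_of_nonneg_right h3 hE0.le) hF0
  /- NEAR PAIRS -/
  push Not at hnear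
  -- chart coordinates of the two base points
  obtain ⟨hz₁, hxz₁⟩ := cubePt_boxCoord hPd hfit0 hx₁
  obtain ⟨hz₂, hxz₂⟩ := cubePt_boxCoord hPd hfit0 hx₂
  set z₁ := boxCoord hPd (P.L ^ k) c x₁ with hz₁def
  set z₂ := boxCoord hPd (P.L ^ k) c x₂ with hz₂def
  have hdT : ((d : ℝ) + 2) * T12 ≤ ((d : ℝ) + 2) * (P.L : ℝ) ^ k := mul_le_mul_of_nonneg_left hnear (by positivity)
  have hdT1 : 0 ≤ ((d : ℝ) + 1) * T12 := by positivity
  have hRbig : ρm + 1 + ((d : ℝ) + 2) * T12 < R := by linarith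
  have hdeepT : ∀ i, T12 ≤ (z₁ i : ℝ) ∧ (z₁ i : ℝ) + T12 ≤ (P.L ^ k * M0 i : ℕ) - 1 := fun i => by
    have h1 := hdeep₁ i
    constructor <;> linarith only [h1.1, h1.2, hnear, hR, hρm0, hR₀, hL1]
  have hclose : ∀ i, ((|z₁ i - z₂ i| : ℤ) : ℝ) ≤ T12 := (mem_and_abs_sub_le_of_T_le hPd hfit0 hdeepT le_rfl).2
  have hroom₁ : ∀ j, z₁ j + 1 < ((P.L ^ k * M0 j : ℕ) : ℤ) := fun j => by
    have h1 : ((z₁ j : ℤ) : ℝ) + 2 ≤ ((P.L ^ k * M0 j : ℕ) : ℝ) := by linarith only [(hdeep₁ j).2, hR1, hR₀]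
    have h2 : z₁ j + 2 ≤ ((P.L ^ k * M0 j : ℕ) : ℤ) := by exact_mod_cast h1
    omega
  have hroom₂ : ∀ j, z₂ j + 1 < ((P.L ^ k * M0 j : ℕ) : ℤ) := fun j => by
    have h1 : ((z₂ j : ℤ) : ℝ) + 2 ≤ ((P.L ^ k * M0 j : ℕ) : ℝ) := by linarith only [(hdeep₂ j).2, hR1, hR₀]
    have h2 : z₂ j + 2 ≤ ((P.L ^ k * M0 j : ℕ) : ℤ) := by exact_mod_cast h1
    omega
  have hl1 : ∑ j, ((|z₂ j - z₁ j| : ℤ) : ℝ) ≤ ((d : ℝ) + 1) * T12 := by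
    calc ∑ j, ((|z₂ j - z₁ j| : ℤ) : ℝ) ≤ ∑ _j : Fin (d + 1), T12 :=
          Finset.sum_le_sum fun j _ => by rw [abs_sub_comm]; exact hclose j
      _ = ((d : ℝ) + 1) * T12 := by rw [Finset.sum_const, Finset.card_univ, Fintype.card_fin, nsmul_eq_mul]; push_cast; ring
  -- the weight against one factor `T12`: `w·T12 ≤ L^k`
  have hwT : w * T12 ≤ (P.L : ℝ) ^ k := by
    rcases hT0.eq_or_lt with hT00 | hTpos
    · rw [← hT00, mul_zero]; exact hLk.le
    · have hq : 1 ≤ (P.L : ℝ) ^ k / T12 := by rw [le_div_iff₀ hTpos, one_mul]; exact hnear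
      calc w * T12 ≤ (P.L : ℝ) ^ k / T12 * T12 := mul_le_mul_of_nonneg_right (rpow_le_self_of_one_le' hq hθ1.le) hT0
        _ = (P.L : ℝ) ^ k := div_mul_cancel₀ _ hTpos.ne'
  -- distances between the four end points and to the contour sites
  have hT2'2 : B5Ineq137Torus.T P 0 x₂' x₂ ≤ 1 := by rw [B5Ineq137Torus.T_symm]; exact T_shift_le_one x₂ μ
  have hT1'1 : B5Ineq137Torus.T P 0 x₁' x₁ ≤ 1 := by rw [B5Ineq137Torus.T_symm]; exact T_shift_le_one x₁ μ
  have hT21 : B5Ineq137Torus.T P 0 x₂ x₁ = T12 := by rw [B5Ineq137Torus.T_symm]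
  have hT2'1 : B5Ineq137Torus.T P 0 x₂' x₁ ≤ 1 + T12 := by
    have := B5Ineq137Torus.T_triangle P 0 x₂' x₂ x₁; linarith only [this, hT2'2, hT21]
  have hT2'1' : B5Ineq137Torus.T P 0 x₂' x₁' ≤ 2 + T12 := by
    have h1 := B5Ineq137Torus.T_triangle P 0 x₂' x₁ x₁'; have h2 := T_shift_le_one (P := P) x₁ μ; linarith only [h1, h2, hT2'1]
  have hlenT : (l.length : ℝ) ≤ ((d : ℝ) + 1) * T12 := hlen
  have hchainT : ∀ z ∈ x₁ :: l, B5Ineq137Torus.T P 0 x₁ z ≤ ((d : ℝ) + 1) * T12 := fun z hz =>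
    (T_le_length_of_isSChain x₁ l hch z hz).trans hlenT
  have hchain2' : ∀ z ∈ x₁ :: l, B5Ineq137Torus.T P 0 x₂' z ≤ 1 + ((d : ℝ) + 2) * T12 := fun z hz => by
    have h1 := B5Ineq137Torus.T_triangle P 0 x₂' x₁ z; have h2 := hchainT z hz
    linarith only [h1, h2, hT2'1, hT0]
  have hchain2 : ∀ z ∈ x₁ :: l, B5Ineq137Torus.T P 0 x₂ z ≤ 1 + ((d : ℝ) + 2) * T12 := fun z hz => by
    have h1 := B5Ineq137Torus.T_triangle P 0 x₂ x₁ z; have h2 := hchainT z hz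
    linarith only [h1, h2, hT21, hT0]
  -- the active-label sets of the four end points
  have hmem : ∀ x : Balaban1983to89.Site P 0, x ∈ blockK k (blkIter k x) := fun x => mem_blockK.2 rfl
  set S : Balaban1983to89.Site P 0 → Finset ↥(labels (P.L ^ k) M0 sg) := fun p =>
    (activeLabels hPd (P.L ^ k) c sg R₀ (blkIter k p)).subtype fun α => α ∈ labels (P.L ^ k) M0 sg with hSdef
  have hcard : ∀ p, ((S p).card : ℝ) ≤ m := fun p => by
    have h1 := card_subtype_activeLabels_le (hPd := hPd) (c := c) (M0 := M0) hn hs0 hR₀ (blkIter k p)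
    have e1 : (((P.L ^ k : ℕ) : ℕ) : ℝ) = (P.L : ℝ) ^ k := by push_cast; rfl
    rw [e1] at h1; exact h1
  have hS : ∀ (p : Balaban1983to89.Site P 0),
      (∀ i, R₀ ≤ (boxCoord hPd (P.L ^ k) c p i : ℝ) ∧ (boxCoord hPd (P.L ^ k) c p i : ℝ) + R₀ ≤ (P.L ^ k * M0 i : ℕ) - 1) →
      ∀ (α : ↥(labels (P.L ^ k) M0 sg)) (y : Balaban1983to89.Site P 0), ζ p y * lamFam hPd (P.L ^ k) c M0 sg α p y ≠ 0 → α ∈ S p := by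
    intro p hdeep α y hne'
    rw [hSdef, Finset.mem_subtype]
    exact mem_activeLabels_of_ne_zero_of_deep hk hs0 hfit0 hζ0 (hmem p) hdeep hne'
  -- a hull active at a deep point `p` has every point within `t` of `p` among its `rowMargin`-deep rows, `rowMargin + t < R`
  have deepα : ∀ (α : ↥(labels (P.L ^ k) M0 sg)) (p : Balaban1983to89.Site P 0), p ∈ Ω₀ →
      (∀ i, R₀ + R ≤ (boxCoord hPd (P.L ^ k) c p i : ℝ) ∧ (boxCoord hPd (P.L ^ k) c p i : ℝ) + (R₀ + R) ≤ (P.L ^ k * M0 i : ℕ) - 1) →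
      (∃ y, ζ p y * lamFam hPd (P.L ^ k) c M0 sg α p y ≠ 0) →
      ∀ (q : Balaban1983to89.Site P 0) (t : ℝ), B5Ineq137Torus.T P 0 p q ≤ t → ρm + t < R → q ∈ deepRows ρm (cubeB α) := by
    intro α p hp hdeep hex q t hpq ht
    obtain ⟨y₀, hy₀⟩ := hex
    obtain ⟨-, -, hfar⟩ := rowHyp_ii_hull hPd hn hs0 hfit0 hR0 hR₀ hρR hgap hW (L ^ k * L ^ s) hζ0 hp hdeep α y₀ hy₀
    refine mem_deepRows.2 fun y hy => ?_
    by_contra hnot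
    have h1 := (hfar y hnot).1
    have h2 := B5Ineq137Torus.T_triangle P 0 p q y
    linarith only [h1, h2, hy, hpq, ht]
  have hrow_of_deep : ∀ {α : ↥(labels (P.L ^ k) M0 sg)} {q : Balaban1983to89.Site P 0}, q ∈ deepRows ρm (cubeB α) →
      ∀ y, B5Ineq137Torus.T P 0 q y ≤
        ((2 * (5 * (L ^ k * L ^ s) / 8 + L ^ k) + 2 * (L ^ k * L ^ s) * (d + 1 + 1) + 1 : ℕ) : ℝ) → y ∈ cubeB α := by
    intro α q hq y hy
    refine (mem_deepRows.1 hq) y ?_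
    rw [hρmdef]; unfold rowMargin
    exact hy
  -- the row sources and their vanishing
  set gs : Balaban1983to89.Site P 0 → ↥(labels (P.L ^ k) M0 sg) → Balaban1983to89.Site P 0 → ℂ :=
    fun p α y => (ζ p y : ℂ) * (lamFam hPd (P.L ^ k) c M0 sg α p y : ℂ) * f y with hgsdef
  set ds : Balaban1983to89.Site P 0 → Balaban1983to89.Site P 0 → ↥(labels (P.L ^ k) M0 sg) → Balaban1983to89.Site P 0 → ℂ :=
    fun p p' α y => ((ζ p' y : ℂ) * (lamFam hPd (P.L ^ k) c M0 sg α p' y : ℂ) - (ζ p y : ℂ) * (lamFam hPd (P.L ^ k) c M0 sg α p y : ℂ)) * f y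
    with hdsdef
  have hgs0 : ∀ (p : Balaban1983to89.Site P 0) (α : ↥(labels (P.L ^ k) M0 sg)),
      (¬∃ y, ζ p y * lamFam hPd (P.L ^ k) c M0 sg α p y ≠ 0) → gs p α = 0 := by
    intro p α hex
    push Not at hex
    funext y; rw [hgsdef]; dsimp only; rw [← Complex.ofReal_mul, hex y, Complex.ofReal_zero, zero_mul]; rfl
  have hds0 : ∀ (p p' : Balaban1983to89.Site P 0) (α : ↥(labels (P.L ^ k) M0 sg)),
      (¬∃ y, ζ p' y * lamFam hPd (P.L ^ k) c M0 sg α p' y ≠ 0) → (¬∃ y, ζ p y * lamFam hPd (P.L ^ k) c M0 sg α p y ≠ 0) → ds p p' α = 0 := by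
    intro p p' α hex' hex
    push Not at hex hex'
    funext y; rw [hdsdef]; dsimp only; rw [← Complex.ofReal_mul, ← Complex.ofReal_mul, hex y, hex' y]; simp
  have hgs_le : ∀ p α y, ‖gs p α y‖ ≤ F := fun p α y =>
    norm_rowSource_le (hζabs p y) (abs_lam_le_one (sum_abs_lamT_le_one hfit0) α p y) hF y
  have hgs_supp : ∀ p α y, gs p α y ≠ 0 → f y ≠ 0 := fun p α y hy => (rowSource_ne_zero hy).2
  have hds_supp : ∀ p p' α y, ds p p' α y ≠ 0 → f y ≠ 0 := fun p p' α y hy => right_ne_zero_of_mul hy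
  -- the bond identity at both bonds
  have hid₁ : X₁ = ∑ α, covD P.eps⁻¹ (cfg U) (gBox A' P.eps⁻¹ U k (cubeB α) *ᵥ gs x₁' α) ⟨x₁, μ⟩ +
      ∑ α, ((P.eps⁻¹ : ℝ) : ℂ) * (gBox A' P.eps⁻¹ U k (cubeB α) *ᵥ ds x₁ x₁' α) x₁ :=
    covD_gLocT_apply P.eps⁻¹ (cfg U) A' P.eps⁻¹ U k cubeB (lamFam hPd (P.L ^ k) c M0 sg) ζ f ⟨x₁, μ⟩
  have hid₂ : X₂ = ∑ α, covD P.eps⁻¹ (cfg U) (gBox A' P.eps⁻¹ U k (cubeB α) *ᵥ gs x₂' α) ⟨x₂, μ⟩ +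
      ∑ α, ((P.eps⁻¹ : ℝ) : ℂ) * (gBox A' P.eps⁻¹ U k (cubeB α) *ᵥ ds x₂ x₂' α) x₂ :=
    covD_gLocT_apply P.eps⁻¹ (cfg U) A' P.eps⁻¹ U k cubeB (lamFam hPd (P.L ^ k) c M0 sg) ζ f ⟨x₂, μ⟩
  rw [hid₁, hid₂]
  -- the four families of summands
  set Ec : ℂ := ((P.eps⁻¹ : ℝ) : ℂ) with hEcdef
  have hEc : ‖Ec‖ = P.eps⁻¹ := by rw [hEcdef, Complex.norm_real, Real.norm_eq_abs, abs_of_pos (inv_pos.mpr heps)]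
  set G : ↥(labels (P.L ^ k) M0 sg) → Matrix (Balaban1983to89.Site P 0) (Balaban1983to89.Site P 0) ℂ :=
    fun α => gBox A' P.eps⁻¹ U k (cubeB α) with hGdef
  set sA : ↥(labels (P.L ^ k) M0 sg) → ℂ :=
    fun α => τ * covD P.eps⁻¹ (cfg U) (G α *ᵥ gs x₂' α) ⟨x₂, μ⟩ - covD P.eps⁻¹ (cfg U) (G α *ᵥ gs x₂' α) ⟨x₁, μ⟩ with hsAdef
  set sB : ↥(labels (P.L ^ k) M0 sg) → ℂ :=
    fun α => covD P.eps⁻¹ (cfg U) (G α *ᵥ gs x₂' α) ⟨x₁, μ⟩ - covD P.eps⁻¹ (cfg U) (G α *ᵥ gs x₁' α) ⟨x₁, μ⟩ with hsBdef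
  set sC : ↥(labels (P.L ^ k) M0 sg) → ℂ :=
    fun α => τ * (Ec * (G α *ᵥ ds x₂ x₂' α) x₂) - Ec * (G α *ᵥ ds x₂ x₂' α) x₁ with hsCdef
  set sD : ↥(labels (P.L ^ k) M0 sg) → ℂ :=
    fun α => Ec * (G α *ᵥ ds x₂ x₂' α) x₁ - Ec * (G α *ᵥ ds x₁ x₁' α) x₁ with hsDdef
  have hdecomp : τ * (∑ α, covD P.eps⁻¹ (cfg U) (G α *ᵥ gs x₂' α) ⟨x₂, μ⟩ + ∑ α, Ec * (G α *ᵥ ds x₂ x₂' α) x₂) -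
      (∑ α, covD P.eps⁻¹ (cfg U) (G α *ᵥ gs x₁' α) ⟨x₁, μ⟩ + ∑ α, Ec * (G α *ᵥ ds x₁ x₁' α) x₁) =
      (∑ α, sA α + ∑ α, sB α) + (∑ α, sC α + ∑ α, sD α) := by
    simp only [hsAdef, hsBdef, hsCdef, hsDdef, hGdef, Finset.sum_sub_distrib, mul_add, Finset.mul_sum]
    ring
  /- TERM A: [7] (1.9) at the regular `u` for each hull active at `x₂'`, fixed source -/
  set BA : ℝ := P.spacing k * (cH * Real.exp (-(δ₄ * (((P.L : ℝ) ^ k)⁻¹ * D))) * F) with hBAdef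
  have hBA0 : 0 ≤ BA := by rw [hBAdef]; positivity
  have hsA0 : ∀ α, gs x₂' α = 0 → sA α = 0 := fun α h0 => by
    simp only [hsAdef]; rw [h0, mulVec_zero, covD_zero, covD_zero, mul_zero, sub_zero]
  have hlen' : (l.length : ℝ) ≤ ((d + 1 : ℕ) : ℝ) * B5Ineq137Torus.T P 0 x₁ x₂ := by push_cast; exact hlen
  have htermA : ∀ α, w * ‖sA α‖ ≤ BA := by
    intro α
    by_cases hex : ∃ y, ζ x₂' y * lamFam hPd (P.L ^ k) c M0 sg α x₂' y ≠ 0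
    · have h1 : x₁ ∈ deepRows ρm (cubeB α) :=
        deepα α x₂' hx₂e hdeep₂e hex x₁ (1 + T12) hT2'1 (by linarith only [hRbig, hdT1, hT0])
      have h2 : x₂ ∈ deepRows ρm (cubeB α) := deepα α x₂' hx₂e hdeep₂e hex x₂ 1 hT2'2 (by linarith only [hRbig, hdT1, hT0])
      have key := GH P hPd hPL hk1 hkK hks hsize (cubeB α) (bbHull_bigBlock _ _) A hec heceH (fun z _ μ' ν => hreg z μ' ν) μ x₁ x₂ hne
        (hrow_of_deep h1) (hrow_of_deep h2) l hch hend hlen' (gs x₂' α) F D (hgs_le x₂' α)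
        (fun y hy => hsupp₁ y (hgs_supp x₂' α y hy)) (fun y hy => hsupp₂ y (hgs_supp x₂' α y hy))
      exact key
    · rw [hsA0 α (hgs0 x₂' α hex), norm_zero, mul_zero]; exact hBA0
  have hzeroA : ∀ α, α ∉ S x₂' → sA α = 0 := fun α hα =>
    hsA0 α (hgs0 x₂' α fun ⟨y, hy⟩ => hα (hS x₂' hdeep₂e₀ α y hy))
  have hsumA : w * ‖∑ α, sA α‖ ≤ m * BA := by
    rw [← Finset.sum_subset (Finset.subset_univ (S x₂')) (fun α _ hα => hzeroA α hα)]
    calc w * ‖∑ α ∈ S x₂', sA α‖ ≤ w * ∑ α ∈ S x₂', ‖sA α‖ := mul_le_mul_of_nonneg_left (norm_sum_le _ _) hw0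
      _ = ∑ α ∈ S x₂', w * ‖sA α‖ := Finset.mul_sum _ _ _
      _ ≤ ∑ α ∈ S x₂', BA := Finset.sum_le_sum fun α _ => htermA α
      _ = (S x₂').card * BA := by rw [Finset.sum_const, nsmul_eq_mul]
      _ ≤ m * BA := mul_le_mul_of_nonneg_right (hcard x₂') hBA0
  /- TERM B: the derivative member of [7] (1.10) at `⟨x₁, x₁+e_μ⟩` on the difference of the row sources of `x₂'` and `x₁'` -/
  set Λ₁ : ℝ := K₁ / (R₀ - R₁) + 3 * Real.pi * (d + 1 : ℕ) / (2 * sg) with hΛ₁def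
  have hΛ₁0 : 0 ≤ Λ₁ := by rw [hΛ₁def]; positivity
  set dB : ↥(labels (P.L ^ k) M0 sg) → Balaban1983to89.Site P 0 → ℂ := fun α y =>
    ((ζ x₂' y * lamFam hPd (P.L ^ k) c M0 sg α x₂' y - ζ x₁' y * lamFam hPd (P.L ^ k) c M0 sg α x₁' y : ℝ) : ℂ) * f y with hdBdef
  have hdB : ∀ α, gs x₂' α - gs x₁' α = dB α := fun α => by
    funext y; simp only [hgsdef, hdBdef, Pi.sub_apply]; push_cast; ring
  have hsB_eq : ∀ α, sB α = covD P.eps⁻¹ (cfg U) (G α *ᵥ dB α) ⟨x₁, μ⟩ := fun α => by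
    simp only [hsBdef]; rw [covD_mulVec_sub, hdB]
  have hdB_le : ∀ α y, ‖dB α y‖ ≤ Λ₁ * (((d : ℝ) + 1) * T12) * F := by
    intro α y
    have h1 := abs_weight_shift_sub_le_of_hull (hPd := hPd) (c := c) hs0 hfit0 hN0 hK₁' hζabs hζ1 α.1 hz₁ hz₂ hroom₁ hroom₂ μ y
    rw [hxz₁, hxz₂] at h1
    simp only [hdBdef]
    rw [norm_mul, Complex.norm_real, Real.norm_eq_abs]
    refine mul_le_mul (h1.trans ?_) (hF y) (norm_nonneg _) (by positivity)
    exact mul_le_mul_of_nonneg_left hl1 hΛ₁0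
  set BB : ℝ := P.spacing k * (c₁ * Real.exp (-(δ₄ * (((P.L : ℝ) ^ k)⁻¹ * D))) * (Λ₁ * (((d : ℝ) + 1) * T12) * F)) with hBBdef
  have hBB0 : 0 ≤ BB := by rw [hBBdef]; positivity
  have htermB : ∀ α, ‖sB α‖ ≤ BB := by
    intro α
    by_cases hex : (∃ y, ζ x₂' y * lamFam hPd (P.L ^ k) c M0 sg α x₂' y ≠ 0) ∨ (∃ y, ζ x₁' y * lamFam hPd (P.L ^ k) c M0 sg α x₁' y ≠ 0)
    · have hx₁d : x₁ ∈ deepRows ρm (cubeB α) := by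
        rcases hex with hex | hex
        · exact deepα α x₂' hx₂e hdeep₂e hex x₁ (1 + T12) hT2'1 (by linarith only [hRbig, hdT1, hT0])
        · exact deepα α x₁' hx₁e hdeep₁e hex x₁ 1 hT1'1 (by linarith only [hRbig, hdT1, hT0])
      have key := G1 P hPd hPL hk1 hkK hks hsize (cubeB α) (bbHull_bigBlock _ _) A hec hece₁ (fun z _ μ' ν => hreg z μ' ν) x₁
        (hrow_of_deep hx₁d) (dB α) (Λ₁ * (((d : ℝ) + 1) * T12) * F) D (hdB_le α)
        (fun y hy => hsupp₁ y (right_ne_zero_of_mul hy)) μ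
      rw [hsB_eq α]
      exact key
    · push Not at hex
      simp only [hsBdef]
      rw [hgs0 x₂' α (not_exists.2 fun y hy => hy (hex.1 y)), hgs0 x₁' α (not_exists.2 fun y hy => hy (hex.2 y))]
      simp only [mulVec_zero, covD_zero, sub_self, norm_zero]
      exact hBB0
  have hzeroB : ∀ α, α ∉ S x₂' ∪ S x₁' → sB α = 0 := by
    intro α hα
    rw [Finset.mem_union, not_or] at hα
    simp only [hsBdef]
    rw [hgs0 x₂' α fun ⟨y, hy⟩ => hα.1 (hS x₂' hdeep₂e₀ α y hy), hgs0 x₁' α fun ⟨y, hy⟩ => hα.2 (hS x₁' hdeep₁e₀ α y hy)]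
    simp only [mulVec_zero, covD_zero, sub_self]
  have hsumB : ‖∑ α, sB α‖ ≤ 2 * m * BB := by
    rw [← Finset.sum_subset (Finset.subset_univ (S x₂' ∪ S x₁')) (fun α _ hα => hzeroB α hα)]
    have hcardU : (((S x₂' ∪ S x₁').card : ℕ) : ℝ) ≤ 2 * m := by
      have h1 : (((S x₂' ∪ S x₁').card : ℕ) : ℝ) ≤ ((S x₂').card : ℝ) + ((S x₁').card : ℝ) := by
        exact_mod_cast Finset.card_union_le _ _
      linarith only [h1, hcard x₂', hcard x₁']
    calc ‖∑ α ∈ S x₂' ∪ S x₁', sB α‖ ≤ ∑ α ∈ S x₂' ∪ S x₁', ‖sB α‖ := norm_sum_le _ _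
      _ ≤ ∑ α ∈ S x₂' ∪ S x₁', BB := Finset.sum_le_sum fun α _ => htermB α
      _ = (S x₂' ∪ S x₁').card * BB := by rw [Finset.sum_const, nsmul_eq_mul]
      _ ≤ 2 * m * BB := mul_le_mul_of_nonneg_right hcardU hBB0
  /- TERM C: the transported difference of the values of `G_α(Δ_μ-source of x₂)` between `x₁` and `x₂`, telescoped ALONG `Γ` at the non-flat `u` -/
  have hds_le : ∀ α y, ‖ds x₂ x₂' α y‖ ≤ Λ₁ * F := fun α y =>
    norm_rowSource_sub_le_of_lipschitz hPd hs0 hfit0 hN0 hK₁' hζabs (fun y => hζ1 x₂ y μ) α.1 hx₂ hx₂e hF y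
  -- the shortened support distance seen from the contour sites
  set D' : ℝ := max (D - ((d : ℝ) + 1) * T12) 0 with hD'def
  have hD'0 : 0 ≤ D' := le_max_right _ _
  have hD'supp : ∀ z ∈ x₁ :: l, ∀ y, f y ≠ 0 → D' ≤ B5Ineq137Torus.T P 0 z y := by
    intro z hz y hy
    refine max_le ?_ (B5Ineq137Torus.T_nonneg P 0 _ y)
    have h1 := hsupp₁ y hy
    have h2 := B5Ineq137Torus.T_triangle P 0 x₁ z y
    linarith only [h1, h2, hchainT z hz]
  have hexpD' : Real.exp (-(δ₄ * (((P.L : ℝ) ^ k)⁻¹ * D'))) ≤ Real.exp (((d : ℝ) + 1) * δ₄) * Ex := by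
    have h1 : D - ((d : ℝ) + 1) * T12 ≤ D' := le_max_left _ _
    have h2 : ((P.L : ℝ) ^ k)⁻¹ * T12 ≤ 1 := by rw [inv_mul_le_iff₀ hLk, mul_one]; exact hnear
    have h3 : -(δ₄ * (((P.L : ℝ) ^ k)⁻¹ * D')) ≤ ((d : ℝ) + 1) * δ₄ + -(δ * (((P.L : ℝ) ^ k)⁻¹ * D)) := by
      have h4 : δ₄ * (((P.L : ℝ) ^ k)⁻¹ * (D - ((d : ℝ) + 1) * T12)) ≤ δ₄ * (((P.L : ℝ) ^ k)⁻¹ * D') :=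
        mul_le_mul_of_nonneg_left (mul_le_mul_of_nonneg_left h1 hLkinv.le) hδ₄0.le
      have h5 : δ * (((P.L : ℝ) ^ k)⁻¹ * D) ≤ δ₄ * (((P.L : ℝ) ^ k)⁻¹ * D) := mul_le_mul_of_nonneg_right hδ4 hεD
      have h6 : δ₄ * (((d : ℝ) + 1) * (((P.L : ℝ) ^ k)⁻¹ * T12)) ≤ δ₄ * (((d : ℝ) + 1) * 1) :=
        mul_le_mul_of_nonneg_left (mul_le_mul_of_nonneg_left h2 (by positivity)) hδ₄0.le
      have h7 : δ₄ * (((P.L : ℝ) ^ k)⁻¹ * (D - ((d : ℝ) + 1) * T12)) =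
          δ₄ * (((P.L : ℝ) ^ k)⁻¹ * D) - δ₄ * (((d : ℝ) + 1) * (((P.L : ℝ) ^ k)⁻¹ * T12)) := by ring
      linarith only [h4, h5, h6, h7]
    calc Real.exp (-(δ₄ * (((P.L : ℝ) ^ k)⁻¹ * D'))) ≤ Real.exp (((d : ℝ) + 1) * δ₄ + -(δ * (((P.L : ℝ) ^ k)⁻¹ * D))) :=
          Real.exp_le_exp.2 h3
      _ = Real.exp (((d : ℝ) + 1) * δ₄) * Ex := by rw [Real.exp_add]
  set BC : ℝ := P.spacing k * (c₁ * Real.exp (-(δ₄ * (((P.L : ℝ) ^ k)⁻¹ * D'))) * (Λ₁ * F)) with hBCdef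
  have hBC0 : 0 ≤ BC := by rw [hBCdef]; positivity
  have htermC : ∀ α, ‖sC α‖ ≤ BC * (((d : ℝ) + 1) * T12) := by
    intro α
    by_cases hex : (∃ y, ζ x₂' y * lamFam hPd (P.L ^ k) c M0 sg α x₂' y ≠ 0) ∨ (∃ y, ζ x₂ y * lamFam hPd (P.L ^ k) c M0 sg α x₂ y ≠ 0)
    · -- every contour site is a `rowMargin`-deep row of the hull
      have hzdeep : ∀ z ∈ x₁ :: l, z ∈ deepRows ρm (cubeB α) := by
        intro z hz
        rcases hex with hex | hex
        · exact deepα α x₂' hx₂e hdeep₂e hex z (1 + ((d : ℝ) + 2) * T12) (hchain2' z hz) (by linarith only [hRbig])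
        · exact deepα α x₂ hx₂ hdeep₂ hex z (1 + ((d : ℝ) + 2) * T12) (hchain2 z hz) (by linarith only [hRbig])
      have hbond : ∀ z ∈ x₁ :: l, ∀ ν : Fin P.d, ‖covD P.eps⁻¹ (cfg (expGauge P e A)) (G α *ᵥ ds x₂ x₂' α) ⟨z, ν⟩‖ ≤ BC := by
        intro z hz ν
        have key := G1 P hPd hPL hk1 hkK hks hsize (cubeB α) (bbHull_bigBlock _ _) A hec hece₁ (fun z _ μ' ν => hreg z μ' ν) z
          (hrow_of_deep (hzdeep z hz)) (ds x₂ x₂' α) (Λ₁ * F) D' (hds_le α)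
          (fun y hy => hD'supp z hz y (hds_supp x₂ x₂' α y hy)) ν
        exact key
      have htel := norm_holA_mul_sub_le hS2 e A (G α *ᵥ ds x₂ x₂' α) hBC0 x₁ l hch hbond
      rw [hend] at htel
      have e1 : sC α = Ec * (τ * (G α *ᵥ ds x₂ x₂' α) x₂ - (G α *ᵥ ds x₂ x₂' α) x₁) := by simp only [hsCdef]; ring
      rw [e1, norm_mul, hEc]
      calc P.eps⁻¹ * ‖τ * (G α *ᵥ ds x₂ x₂' α) x₂ - (G α *ᵥ ds x₂ x₂' α) x₁‖
          ≤ P.eps⁻¹ * (P.eps * l.length * BC) := mul_le_mul_of_nonneg_left htel (inv_pos.mpr heps).le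
        _ = l.length * BC := by field_simp
        _ ≤ (((d : ℝ) + 1) * T12) * BC := mul_le_mul_of_nonneg_right hlenT hBC0
        _ = BC * (((d : ℝ) + 1) * T12) := mul_comm _ _
    · push Not at hex
      simp only [hsCdef]
      rw [hds0 x₂ x₂' α (not_exists.2 fun y hy => hy (hex.1 y)) (not_exists.2 fun y hy => hy (hex.2 y))]
      simp only [mulVec_zero, Pi.zero_apply, mul_zero, sub_zero, norm_zero]
      positivity
  have hzeroC : ∀ α, α ∉ S x₂' ∪ S x₂ → sC α = 0 := by
    intro α hα
    rw [Finset.mem_union, not_or] at hα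
    simp only [hsCdef]
    rw [hds0 x₂ x₂' α (fun ⟨y, hy⟩ => hα.1 (hS x₂' hdeep₂e₀ α y hy)) (fun ⟨y, hy⟩ => hα.2 (hS x₂ hdeep₂₀ α y hy))]
    simp only [mulVec_zero, Pi.zero_apply, mul_zero, sub_zero]
  have hsumC : ‖∑ α, sC α‖ ≤ 2 * m * (BC * (((d : ℝ) + 1) * T12)) := by
    rw [← Finset.sum_subset (Finset.subset_univ (S x₂' ∪ S x₂)) (fun α _ hα => hzeroC α hα)]
    have hcardU : (((S x₂' ∪ S x₂).card : ℕ) : ℝ) ≤ 2 * m := by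
      have h1 : (((S x₂' ∪ S x₂).card : ℕ) : ℝ) ≤ ((S x₂').card : ℝ) + ((S x₂).card : ℝ) := by
        exact_mod_cast Finset.card_union_le _ _
      linarith only [h1, hcard x₂', hcard x₂]
    calc ‖∑ α ∈ S x₂' ∪ S x₂, sC α‖ ≤ ∑ α ∈ S x₂' ∪ S x₂, ‖sC α‖ := norm_sum_le _ _
      _ ≤ ∑ α ∈ S x₂' ∪ S x₂, BC * (((d : ℝ) + 1) * T12) := Finset.sum_le_sum fun α _ => htermC α
      _ = (S x₂' ∪ S x₂).card * (BC * (((d : ℝ) + 1) * T12)) := by rw [Finset.sum_const, nsmul_eq_mul]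
      _ ≤ 2 * m * (BC * (((d : ℝ) + 1) * T12)) := mul_le_mul_of_nonneg_right hcardU (by positivity)
  /- TERM D: [7] (1.10), value member, on the difference of the bond-difference sources of `x₂` and `x₁` -/
  set Λ₂ : ℝ := K₂ / (R₀ - R₁) ^ 2 + 4 * Real.pi ^ 2 / (sg : ℝ) ^ 2 + 2 * (K₁ / (R₀ - R₁) * (3 * Real.pi * (d + 1 : ℕ) / (2 * sg)))
    with hΛ₂def
  have hΛ₂0 : 0 ≤ Λ₂ := by rw [hΛ₂def]; positivity
  set dD : ↥(labels (P.L ^ k) M0 sg) → Balaban1983to89.Site P 0 → ℂ := fun α y =>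
    (((ζ x₂' y * lamFam hPd (P.L ^ k) c M0 sg α x₂' y - ζ x₂ y * lamFam hPd (P.L ^ k) c M0 sg α x₂ y) -
        (ζ x₁' y * lamFam hPd (P.L ^ k) c M0 sg α x₁' y - ζ x₁ y * lamFam hPd (P.L ^ k) c M0 sg α x₁ y) : ℝ) : ℂ) * f y with hdDdef
  have hdD : ∀ α, ds x₂ x₂' α - ds x₁ x₁' α = dD α := fun α => by
    funext y; simp only [hdsdef, hdDdef, Pi.sub_apply]; push_cast; ring
  have hdD' : ∀ α, G α *ᵥ ds x₂ x₂' α - G α *ᵥ ds x₁ x₁' α = G α *ᵥ dD α := fun α => by rw [← Matrix.mulVec_sub, hdD]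
  have hsD_eq : ∀ α, sD α = Ec * (G α *ᵥ dD α) x₁ := fun α => by
    simp only [hsDdef]; rw [← mul_sub, ← hdD', Pi.sub_apply]
  have hdD_le : ∀ α y, ‖dD α y‖ ≤ Λ₂ * (((d : ℝ) + 1) * T12) * F := by
    intro α y
    have h1 := abs_weight_bondDiff_sub_le_of_hull (hPd := hPd) (c := c) hs0 hfit0 hN0 hζabs hζ1 hζ2 α.1 hz₁ hz₂ hroom₁ hroom₂ μ y
    rw [hxz₁, hxz₂] at h1
    simp only [hdDdef]
    rw [norm_mul, Complex.norm_real, Real.norm_eq_abs]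
    refine mul_le_mul (h1.trans ?_) (hF y) (norm_nonneg _) (by positivity)
    exact mul_le_mul_of_nonneg_left hl1 hΛ₂0
  set BD : ℝ := P.spacing k ^ 2 * (c₂ * Real.exp (-(δ * (((P.L : ℝ) ^ k)⁻¹ * D))) * (Λ₂ * (((d : ℝ) + 1) * T12) * F)) with hBDdef
  have hBD0 : 0 ≤ BD := by rw [hBDdef]; positivity
  have htermD : ∀ α, ‖sD α‖ ≤ P.eps⁻¹ * BD := by
    intro α
    by_cases hex : ((∃ y, ζ x₂' y * lamFam hPd (P.L ^ k) c M0 sg α x₂' y ≠ 0) ∨ (∃ y, ζ x₂ y * lamFam hPd (P.L ^ k) c M0 sg α x₂ y ≠ 0)) ∨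
        ((∃ y, ζ x₁' y * lamFam hPd (P.L ^ k) c M0 sg α x₁' y ≠ 0) ∨ (∃ y, ζ x₁ y * lamFam hPd (P.L ^ k) c M0 sg α x₁ y ≠ 0))
    · have hx₁d : x₁ ∈ deepRows ρm (cubeB α) := by
        rcases hex with (hex | hex) | (hex | hex)
        · exact deepα α x₂' hx₂e hdeep₂e hex x₁ (1 + T12) hT2'1 (by linarith only [hRbig, hdT1, hT0])
        · exact deepα α x₂ hx₂ hdeep₂ hex x₁ T12 hT21.le (by linarith only [hRbig, hdT1, hT0])
        · exact deepα α x₁' hx₁e hdeep₁e hex x₁ 1 hT1'1 (by linarith only [hRbig, hdT1, hT0])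
        · exact deepα α x₁ hx₁ hdeep₁ hex x₁ 0 (by rw [B5Ineq137Torus.T_self]) (by linarith only [hRbig, hdT1, hT0])
      have key := I2 (cubeB α) (bbHull_bigBlock _ _) x₁ hx₁d (dD α) (Λ₂ * (((d : ℝ) + 1) * T12) * F) D (hdD_le α) hD
        (fun y hy => hsupp₁ y (right_ne_zero_of_mul hy))
      rw [hsD_eq α, norm_mul, hEc]
      refine mul_le_mul_of_nonneg_left ?_ (inv_pos.mpr heps).le
      exact key
    · push Not at hex
      simp only [hsDdef]
      rw [hds0 x₂ x₂' α (not_exists.2 fun y hy => hy (hex.1.1 y)) (not_exists.2 fun y hy => hy (hex.1.2 y)),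
        hds0 x₁ x₁' α (not_exists.2 fun y hy => hy (hex.2.1 y)) (not_exists.2 fun y hy => hy (hex.2.2 y))]
      simp only [mulVec_zero, Pi.zero_apply, mul_zero, sub_self, norm_zero]
      positivity
  have hzeroD : ∀ α, α ∉ (S x₂' ∪ S x₂) ∪ (S x₁' ∪ S x₁) → sD α = 0 := by
    intro α hα
    simp only [Finset.mem_union, not_or] at hα
    simp only [hsDdef]
    rw [hds0 x₂ x₂' α (fun ⟨y, hy⟩ => hα.1.1 (hS x₂' hdeep₂e₀ α y hy)) (fun ⟨y, hy⟩ => hα.1.2 (hS x₂ hdeep₂₀ α y hy)),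
      hds0 x₁ x₁' α (fun ⟨y, hy⟩ => hα.2.1 (hS x₁' hdeep₁e₀ α y hy)) (fun ⟨y, hy⟩ => hα.2.2 (hS x₁ hdeep₁₀ α y hy))]
    simp only [mulVec_zero, Pi.zero_apply, mul_zero, sub_self]
  have hsumD : ‖∑ α, sD α‖ ≤ 4 * m * (P.eps⁻¹ * BD) := by
    rw [← Finset.sum_subset (Finset.subset_univ ((S x₂' ∪ S x₂) ∪ (S x₁' ∪ S x₁))) (fun α _ hα => hzeroD α hα)]
    have hcardU : (((((S x₂' ∪ S x₂) ∪ (S x₁' ∪ S x₁)).card : ℕ)) : ℝ) ≤ 4 * m := by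
      have h1 : ((((S x₂' ∪ S x₂) ∪ (S x₁' ∪ S x₁)).card : ℕ) : ℝ) ≤ (((S x₂' ∪ S x₂).card : ℕ) : ℝ) + (((S x₁' ∪ S x₁).card : ℕ) : ℝ) := by
        exact_mod_cast Finset.card_union_le _ _
      have h2 : (((S x₂' ∪ S x₂).card : ℕ) : ℝ) ≤ ((S x₂').card : ℝ) + ((S x₂).card : ℝ) := by exact_mod_cast Finset.card_union_le _ _
      have h3 : (((S x₁' ∪ S x₁).card : ℕ) : ℝ) ≤ ((S x₁').card : ℝ) + ((S x₁).card : ℝ) := by exact_mod_cast Finset.card_union_le _ _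
      linarith only [h1, h2, h3, hcard x₂', hcard x₂, hcard x₁', hcard x₁]
    calc ‖∑ α ∈ (S x₂' ∪ S x₂) ∪ (S x₁' ∪ S x₁), sD α‖ ≤ ∑ α ∈ (S x₂' ∪ S x₂) ∪ (S x₁' ∪ S x₁), ‖sD α‖ := norm_sum_le _ _
      _ ≤ ∑ α ∈ (S x₂' ∪ S x₂) ∪ (S x₁' ∪ S x₁), P.eps⁻¹ * BD := Finset.sum_le_sum fun α _ => htermD α
      _ = ((S x₂' ∪ S x₂) ∪ (S x₁' ∪ S x₁)).card * (P.eps⁻¹ * BD) := by rw [Finset.sum_const, nsmul_eq_mul]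
      _ ≤ 4 * m * (P.eps⁻¹ * BD) := mul_le_mul_of_nonneg_right hcardU (by positivity)
  /- ASSEMBLY (verbatim shape of p29's `derivHolder230_flat_of_smooth`) -/
  have hscale : P.eps⁻¹ * P.spacing k ^ 2 = P.spacing k * (P.L : ℝ) ^ k := by
    rw [Params.spacing]
    field_simp
  -- the Lipschitz moduli against the bracket: `L^k·Λ₁ ≤ Λ₀·br`, `(L^k)²·Λ₂ ≤ Λ₀₂·br²`
  have hΛ₁le : (P.L : ℝ) ^ k * Λ₁ ≤ Λ₀ * br := by
    have h1 : Λ₁ ≤ Λ₀ * uv := by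
      rw [hΛ₁def, huvdef, mul_add]
      refine add_le_add ?_ ?_
      · rw [div_eq_mul_inv]
        exact mul_le_mul_of_nonneg_right (le_max_left _ _) (inv_pos.mpr hgap').le
      · have e5 : 3 * Real.pi * (d + 1 : ℕ) / (2 * sg) = (3 * Real.pi * (d + 1 : ℕ) / 2) * (sg : ℝ)⁻¹ := by
          field_simp
        rw [e5]
        exact mul_le_mul_of_nonneg_right (le_max_right _ _) (inv_pos.mpr hsr).le
    calc (P.L : ℝ) ^ k * Λ₁ ≤ (P.L : ℝ) ^ k * (Λ₀ * uv) := mul_le_mul_of_nonneg_left h1 hLk.le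
      _ = Λ₀ * ((P.L : ℝ) ^ k * uv) := by ring
      _ ≤ Λ₀ * br := mul_le_mul_of_nonneg_left hLuv hΛ₀0
  have hΛ₂le : ((P.L : ℝ) ^ k) ^ 2 * Λ₂ ≤ Λ₀₂ * br ^ 2 := by
    have hu : 0 ≤ (R₀ - R₁)⁻¹ := (inv_pos.mpr hgap').le
    have hv : 0 ≤ (sg : ℝ)⁻¹ := (inv_pos.mpr hsr).le
    have h1 : Λ₂ ≤ Λ₀₂ * uv ^ 2 := by
      rw [hΛ₂def, hΛ₀₂def, huvdef]
      have e1 : K₂ / (R₀ - R₁) ^ 2 = K₂ * ((R₀ - R₁)⁻¹) ^ 2 := by rw [div_eq_mul_inv, inv_pow]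
      have e2 : 4 * Real.pi ^ 2 / (sg : ℝ) ^ 2 = 4 * Real.pi ^ 2 * ((sg : ℝ)⁻¹) ^ 2 := by rw [div_eq_mul_inv, inv_pow]
      have e3 : 2 * (K₁ / (R₀ - R₁) * (3 * Real.pi * (d + 1 : ℕ) / (2 * sg))) =
          3 * Real.pi * (d + 1 : ℕ) * K₁ * ((R₀ - R₁)⁻¹ * (sg : ℝ)⁻¹) := by
        rw [div_eq_mul_inv, div_eq_mul_inv, mul_inv]
        ring
      rw [e1, e2, e3]
      have hq1 : ((R₀ - R₁)⁻¹) ^ 2 ≤ ((R₀ - R₁)⁻¹ + (sg : ℝ)⁻¹) ^ 2 := pow_le_pow_left₀ hu (le_add_of_nonneg_right hv) 2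
      have hq2 : ((sg : ℝ)⁻¹) ^ 2 ≤ ((R₀ - R₁)⁻¹ + (sg : ℝ)⁻¹) ^ 2 := pow_le_pow_left₀ hv (le_add_of_nonneg_left hu) 2
      have hq3 : (R₀ - R₁)⁻¹ * (sg : ℝ)⁻¹ ≤ ((R₀ - R₁)⁻¹ + (sg : ℝ)⁻¹) ^ 2 := by
        have e4 : ((R₀ - R₁)⁻¹ + (sg : ℝ)⁻¹) ^ 2 =
            (R₀ - R₁)⁻¹ * (sg : ℝ)⁻¹ + (((R₀ - R₁)⁻¹) ^ 2 + (R₀ - R₁)⁻¹ * (sg : ℝ)⁻¹ + ((sg : ℝ)⁻¹) ^ 2) := by ring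
        rw [e4]
        exact le_add_of_nonneg_right (by positivity)
      have hπ : 0 ≤ 4 * Real.pi ^ 2 := by positivity
      have hπK : 0 ≤ 3 * Real.pi * (d + 1 : ℕ) * K₁ := by positivity
      calc K₂ * ((R₀ - R₁)⁻¹) ^ 2 + 4 * Real.pi ^ 2 * ((sg : ℝ)⁻¹) ^ 2 + 3 * Real.pi * (d + 1 : ℕ) * K₁ * ((R₀ - R₁)⁻¹ * (sg : ℝ)⁻¹)
          ≤ K₂ * ((R₀ - R₁)⁻¹ + (sg : ℝ)⁻¹) ^ 2 + 4 * Real.pi ^ 2 * ((R₀ - R₁)⁻¹ + (sg : ℝ)⁻¹) ^ 2 +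
            3 * Real.pi * (d + 1 : ℕ) * K₁ * ((R₀ - R₁)⁻¹ + (sg : ℝ)⁻¹) ^ 2 :=
            add_le_add (add_le_add (mul_le_mul_of_nonneg_left hq1 hK₂) (mul_le_mul_of_nonneg_left hq2 hπ))
              (mul_le_mul_of_nonneg_left hq3 hπK)
        _ = (K₂ + 4 * Real.pi ^ 2 + 3 * Real.pi * (d + 1 : ℕ) * K₁) * ((R₀ - R₁)⁻¹ + (sg : ℝ)⁻¹) ^ 2 := by ring
    calc ((P.L : ℝ) ^ k) ^ 2 * Λ₂ ≤ ((P.L : ℝ) ^ k) ^ 2 * (Λ₀₂ * uv ^ 2) := mul_le_mul_of_nonneg_left h1 (by positivity)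
      _ = Λ₀₂ * ((P.L : ℝ) ^ k * uv) ^ 2 := by ring
      _ ≤ Λ₀₂ * br ^ 2 := mul_le_mul_of_nonneg_left (pow_le_pow_left₀ (by positivity) hLuv 2) hΛ₀₂0
  -- the four terms in the common shape `spacing·(C_T·m·br²·Ex·F)`
  have hA : w * ‖∑ α, sA α‖ ≤ P.spacing k * (cH * m * br ^ 2 * Ex * F) := by
    refine hsumA.trans ?_
    rw [hBAdef]
    have h1 : cH * Real.exp (-(δ₄ * (((P.L : ℝ) ^ k)⁻¹ * D))) * F ≤ cH * Ex * F :=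
      mul_le_mul_of_nonneg_right (mul_le_mul_of_nonneg_left hE4 hcH.le) hF0
    have h2 : 1 ≤ br ^ 2 := hbr1.trans hbr2
    calc m * (P.spacing k * (cH * Real.exp (-(δ₄ * (((P.L : ℝ) ^ k)⁻¹ * D))) * F)) ≤ m * (P.spacing k * (cH * Ex * F)) :=
          mul_le_mul_of_nonneg_left (mul_le_mul_of_nonneg_left h1 hsp0.le) hm0
      _ = P.spacing k * (cH * m * 1 * Ex * F) := by ring
      _ ≤ P.spacing k * (cH * m * br ^ 2 * Ex * F) := by
          refine mul_le_mul_of_nonneg_left ?_ hsp0.le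
          exact mul_le_mul_of_nonneg_right (mul_le_mul_of_nonneg_right (mul_le_mul_of_nonneg_left h2 (by positivity)) hE0.le) hF0
  have hB : w * ‖∑ α, sB α‖ ≤ P.spacing k * (CB * m * br ^ 2 * Ex * F) := by
    have h1 : w * ‖∑ α, sB α‖ ≤ w * (2 * m * BB) := mul_le_mul_of_nonneg_left hsumB hw0
    refine h1.trans ?_
    have e6 : w * (2 * m * BB) =
        (w * T12) * Λ₁ * (P.spacing k * (2 * ((d : ℝ) + 1) * c₁ * m * Real.exp (-(δ₄ * (((P.L : ℝ) ^ k)⁻¹ * D))) * F)) := by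
      rw [hBBdef]; ring
    rw [e6]
    have h2 : (w * T12) * Λ₁ ≤ Λ₀ * br :=
      le_trans (mul_le_mul_of_nonneg_right hwT hΛ₁0) hΛ₁le
    have h3 : P.spacing k * (2 * ((d : ℝ) + 1) * c₁ * m * Real.exp (-(δ₄ * (((P.L : ℝ) ^ k)⁻¹ * D))) * F) ≤
        P.spacing k * (2 * ((d : ℝ) + 1) * c₁ * m * Ex * F) :=
      mul_le_mul_of_nonneg_left (mul_le_mul_of_nonneg_right (mul_le_mul_of_nonneg_left hE4 (by positivity)) hF0) hsp0.le
    calc (w * T12) * Λ₁ * (P.spacing k * (2 * ((d : ℝ) + 1) * c₁ * m * Real.exp (-(δ₄ * (((P.L : ℝ) ^ k)⁻¹ * D))) * F))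
        ≤ (Λ₀ * br) * (P.spacing k * (2 * ((d : ℝ) + 1) * c₁ * m * Ex * F)) :=
          mul_le_mul h2 h3 (by positivity) (by positivity)
      _ = P.spacing k * (CB * m * br * Ex * F) := by rw [hCBdef]; ring
      _ ≤ P.spacing k * (CB * m * br ^ 2 * Ex * F) := by
          refine mul_le_mul_of_nonneg_left ?_ hsp0.le
          exact mul_le_mul_of_nonneg_right (mul_le_mul_of_nonneg_right (mul_le_mul_of_nonneg_left hbr2 (mul_nonneg hCB0 hm0)) hE0.le) hF0
  have hC : w * ‖∑ α, sC α‖ ≤ P.spacing k * (CC * m * br ^ 2 * Ex * F) := by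
    have h1 : w * ‖∑ α, sC α‖ ≤ w * (2 * m * (BC * (((d : ℝ) + 1) * T12))) := mul_le_mul_of_nonneg_left hsumC hw0
    refine h1.trans ?_
    have e6 : w * (2 * m * (BC * (((d : ℝ) + 1) * T12))) =
        (w * T12) * Λ₁ * (P.spacing k * (2 * ((d : ℝ) + 1) * c₁ * m * Real.exp (-(δ₄ * (((P.L : ℝ) ^ k)⁻¹ * D'))) * F)) := by
      rw [hBCdef]; ring
    rw [e6]
    have h2 : (w * T12) * Λ₁ ≤ Λ₀ * br :=
      le_trans (mul_le_mul_of_nonneg_right hwT hΛ₁0) hΛ₁le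
    have h3 : P.spacing k * (2 * ((d : ℝ) + 1) * c₁ * m * Real.exp (-(δ₄ * (((P.L : ℝ) ^ k)⁻¹ * D'))) * F) ≤
        P.spacing k * (2 * ((d : ℝ) + 1) * c₁ * m * (Real.exp (((d : ℝ) + 1) * δ₄) * Ex) * F) :=
      mul_le_mul_of_nonneg_left (mul_le_mul_of_nonneg_right (mul_le_mul_of_nonneg_left hexpD' (by positivity)) hF0) hsp0.le
    calc (w * T12) * Λ₁ * (P.spacing k * (2 * ((d : ℝ) + 1) * c₁ * m * Real.exp (-(δ₄ * (((P.L : ℝ) ^ k)⁻¹ * D'))) * F))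
        ≤ (Λ₀ * br) * (P.spacing k * (2 * ((d : ℝ) + 1) * c₁ * m * (Real.exp (((d : ℝ) + 1) * δ₄) * Ex) * F)) :=
          mul_le_mul h2 h3 (by positivity) (by positivity)
      _ = P.spacing k * (CC * m * br * Ex * F) := by rw [hCCdef]; ring
      _ ≤ P.spacing k * (CC * m * br ^ 2 * Ex * F) := by
          refine mul_le_mul_of_nonneg_left ?_ hsp0.le
          exact mul_le_mul_of_nonneg_right (mul_le_mul_of_nonneg_right (mul_le_mul_of_nonneg_left hbr2 (mul_nonneg hCC0 hm0)) hE0.le) hF0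
  have hDt : w * ‖∑ α, sD α‖ ≤ P.spacing k * (CD * m * br ^ 2 * Ex * F) := by
    have h1 : w * ‖∑ α, sD α‖ ≤ w * (4 * m * (P.eps⁻¹ * BD)) := mul_le_mul_of_nonneg_left hsumD hw0
    refine h1.trans ?_
    have e6 : w * (4 * m * (P.eps⁻¹ * BD)) =
        (w * T12) * ((P.eps⁻¹ * P.spacing k ^ 2) * (4 * ((d : ℝ) + 1) * c₂ * m * Λ₂ * Real.exp (-(δ * (((P.L : ℝ) ^ k)⁻¹ * D))) * F)) := by
      rw [hBDdef]; ring
    rw [e6, hscale]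
    have e7 : (w * T12) * (P.spacing k * (P.L : ℝ) ^ k * (4 * ((d : ℝ) + 1) * c₂ * m * Λ₂ * Real.exp (-(δ * (((P.L : ℝ) ^ k)⁻¹ * D))) * F)) =
        ((w * T12) * ((P.L : ℝ) ^ k * Λ₂)) * (P.spacing k * (4 * ((d : ℝ) + 1) * c₂ * m * Real.exp (-(δ * (((P.L : ℝ) ^ k)⁻¹ * D))) * F)) := by
      ring
    rw [e7]
    have h2 : (w * T12) * ((P.L : ℝ) ^ k * Λ₂) ≤ Λ₀₂ * br ^ 2 := by
      calc (w * T12) * ((P.L : ℝ) ^ k * Λ₂) ≤ (P.L : ℝ) ^ k * ((P.L : ℝ) ^ k * Λ₂) := mul_le_mul_of_nonneg_right hwT (by positivity)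
        _ = ((P.L : ℝ) ^ k) ^ 2 * Λ₂ := by ring
        _ ≤ Λ₀₂ * br ^ 2 := hΛ₂le
    have h3 : P.spacing k * (4 * ((d : ℝ) + 1) * c₂ * m * Real.exp (-(δ * (((P.L : ℝ) ^ k)⁻¹ * D))) * F) ≤
        P.spacing k * (4 * ((d : ℝ) + 1) * c₂ * m * Ex * F) := by rw [hEdef]
    calc ((w * T12) * ((P.L : ℝ) ^ k * Λ₂)) * (P.spacing k * (4 * ((d : ℝ) + 1) * c₂ * m * Real.exp (-(δ * (((P.L : ℝ) ^ k)⁻¹ * D))) * F))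
        ≤ (Λ₀₂ * br ^ 2) * (P.spacing k * (4 * ((d : ℝ) + 1) * c₂ * m * Ex * F)) :=
          mul_le_mul h2 h3 (by positivity) (by positivity)
      _ = P.spacing k * (CD * m * br ^ 2 * Ex * F) := by rw [hCDdef]; ring
  -- conclusion
  have hsplit : ‖(∑ α, sA α + ∑ α, sB α) + (∑ α, sC α + ∑ α, sD α)‖ ≤
      ‖∑ α, sA α‖ + ‖∑ α, sB α‖ + (‖∑ α, sC α‖ + ‖∑ α, sD α‖) :=
    (norm_add_le _ _).trans (add_le_add (norm_add_le _ _) (norm_add_le _ _))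
  have hCsum : cH + CB + CC + CD ≤ C := by rw [hCdef]; linarith only [hcg.le]
  calc w * ‖τ * (∑ α, covD P.eps⁻¹ (cfg U) (G α *ᵥ gs x₂' α) ⟨x₂, μ⟩ + ∑ α, Ec * (G α *ᵥ ds x₂ x₂' α) x₂) -
        (∑ α, covD P.eps⁻¹ (cfg U) (G α *ᵥ gs x₁' α) ⟨x₁, μ⟩ + ∑ α, Ec * (G α *ᵥ ds x₁ x₁' α) x₁)‖
      = w * ‖(∑ α, sA α + ∑ α, sB α) + (∑ α, sC α + ∑ α, sD α)‖ := by rw [hdecomp]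
    _ ≤ w * (‖∑ α, sA α‖ + ‖∑ α, sB α‖ + (‖∑ α, sC α‖ + ‖∑ α, sD α‖)) := mul_le_mul_of_nonneg_left hsplit hw0
    _ = w * ‖∑ α, sA α‖ + w * ‖∑ α, sB α‖ + (w * ‖∑ α, sC α‖ + w * ‖∑ α, sD α‖) := by ring
    _ ≤ P.spacing k * (cH * m * br ^ 2 * Ex * F) + P.spacing k * (CB * m * br ^ 2 * Ex * F) +
          (P.spacing k * (CC * m * br ^ 2 * Ex * F) + P.spacing k * (CD * m * br ^ 2 * Ex * F)) :=
        add_le_add (add_le_add hA hB) (add_le_add hC hDt)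
    _ = P.spacing k * ((cH + CB + CC + CD) * m * br ^ 2 * Ex * F) := by ring
    _ ≤ P.spacing k * (C * m * br ^ 2 * Ex * F) := by
        refine mul_le_mul_of_nonneg_left ?_ hsp0.le
        exact mul_le_mul_of_nonneg_right (mul_le_mul_of_nonneg_right (mul_le_mul_of_nonneg_right
          (mul_le_mul_of_nonneg_right hCsum hm0) (by positivity)) hE0.le) hF0

end DerivHolder

/-! ## §4 The member for the smooth product cut-off `ζ″ = ζ^Π(R₁, R₀)` of (2.29) -/

section ZetaPiMember

open BIJ88LocDeriv230ZetaPiFlatTorus (zetaPi_zero_eq_zero_of_le abs_zetaPi_zero_le_one abs_zetaPi_zero_shift_sub_le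
  abs_zetaPi_zero_secondDiff_le)
open BIJ88HkLocHolderTorus (zetaPi secondDiffConst)
open BIJ88Close231RegularTorusCwt (cubeFamB rowMargin)
open Literature.Analysis.Calculus (exists_abs_deriv_and_deriv_deriv_smoothTransition_le)

/-- **THE HÖLDER MEMBER OF ORDER `1 + θ` OF (2.30) AT A (2.23)-REGULAR `u = e^{ieεA}` FOR `G_{k,loc}(u)` BUILT FROM THE BIG-BLOCK HULLS, THE
WEIGHTS OF (2.27) AND THE SMOOTH PRODUCT CUT-OFF `ζ″ = ζ^Π(R₁, R₀)` OF (2.29)** (print p. 263: *"ζ_k(x₁, x₂) is a smooth function of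
x₁ − x₂"*, *"Bounds analogous to (2.30), (2.31) hold for covariant derivatives and Holder derivatives of G_{k,loc}(u) of order less than two"*):
for every `0 ≤ θ < 1`, `∃ s₀ ∀ s ≥ s₀ ∃ c₀ e₁ > 0` (from `(d, L, a, e, c, β, θ, s)` and the tree's universal profile bound `C_σ` on `|σ′|`, `|σ″|`
only) such that, for all data as in `derivHolder230_regular_of_smooth` with `1 ≤ R₁ < R₀ ≤ (|T^{(0)}| − 3)/2`,
`(L^k/|x₁ − x₂|_T)^θ·‖U(A(Γ))(D_uG_{k,loc}(u)f)(x₂, μ) − (D_uG_{k,loc}(u)f)(x₁, μ)‖ ≤ (L^kε)·c₀·m·(1 + L^k((R₀−R₁)⁻¹ + s_g⁻¹))²·e^{−δ₀D/L^k}·F`,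
`δ₀ = 1/(8L^s)` — §3 at `K₁ = C_σ`, `K₂ = C_σ² + C_σ` (r18's `abs_zetaPi_shift_sub_le` / `abs_zetaPi_secondDiff_le` through p29's scale-`0`
forms). [cite: BalabanImbrieJaffe1988, (2.30) p.263] [cite: Balaban1983RegularityDecay, (1.9) p.573] -/
theorem derivHolder230_regular_zetaPi (d L : ℕ) (hL : 2 ≤ L) {a : ℝ} (ha : 0 < a) (e creg β : ℝ) (hcreg : 0 ≤ creg) (hβ : 0 < β)
    {θ : ℝ} (hθ0 : 0 ≤ θ) (hθ1 : θ < 1) :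
    ∃ s₀ : ℕ, ∀ s : ℕ, s₀ ≤ s → ∃ c₀ e₁ : ℝ, 0 < c₀ ∧ 0 < e₁ ∧
      ∀ (P : Params) (hPd : P.d = d + 1), P.L = L → ∀ (k : ℕ), 1 ≤ k → k ≤ P.K → k + s ≤ P.m + P.K →
      3 * (L ^ k * L ^ s) ≤ P.sitesPerDir 0 →
      ∀ (A : PBond P 0 → ℝ) (ec : ℝ), 0 < ec → ec ≤ e₁ →
      (∀ (z : Balaban1983to89.Site P 0) (μ ν : Fin P.d),
          P.spacing k * |e| / ec * |A ⟨z.shift μ, ν⟩ - A ⟨z, ν⟩| ≤ creg * ec ^ (β - 1) / (L : ℝ) ^ k) →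
      ∀ (c M0 : Fin (d + 1) → ℕ), (∀ i, c i * P.L ^ k + P.L ^ k * M0 i ≤ P.sitesPerDir 0) → (∀ i, P.L ^ k * M0 i < P.sitesPerDir 0) →
      ∀ (sg W : ℕ), 1 ≤ sg → ∀ (R R₀ R₁ : ℝ), ((rowMargin L (d + 1) k s : ℕ) : ℝ) + ((d : ℝ) + 2) * (P.L : ℝ) ^ k + 1 < R → 1 ≤ R₁ → R₁ < R₀ →
        R₀ ≤ ((P.sitesPerDir 0 : ℝ) - 3) / 2 →
        2 * (sg : ℝ) / 3 + R₀ / 2 + R ≤ W → (∀ i, ((P.L ^ k * M0 i : ℕ) : ℝ) + R ≤ P.sitesPerDir 0) →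
      ∀ (x₁ x₂ : Balaban1983to89.Site P 0) (μ : Fin P.d),
        x₁ ∈ (cubeT hPd (P.L ^ k) c fun i => P.L ^ k * M0 i) →
        (∀ i, R₀ + R ≤ (boxCoord hPd (P.L ^ k) c x₁ i : ℝ) ∧ (boxCoord hPd (P.L ^ k) c x₁ i : ℝ) + (R₀ + R) ≤ (P.L ^ k * M0 i : ℕ) - 1) →
        x₁.shift μ ∈ (cubeT hPd (P.L ^ k) c fun i => P.L ^ k * M0 i) →
        (∀ i, R₀ + R ≤ (boxCoord hPd (P.L ^ k) c (x₁.shift μ) i : ℝ) ∧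
          (boxCoord hPd (P.L ^ k) c (x₁.shift μ) i : ℝ) + (R₀ + R) ≤ (P.L ^ k * M0 i : ℕ) - 1) →
        x₂ ∈ (cubeT hPd (P.L ^ k) c fun i => P.L ^ k * M0 i) →
        (∀ i, R₀ + R ≤ (boxCoord hPd (P.L ^ k) c x₂ i : ℝ) ∧ (boxCoord hPd (P.L ^ k) c x₂ i : ℝ) + (R₀ + R) ≤ (P.L ^ k * M0 i : ℕ) - 1) →
        x₂.shift μ ∈ (cubeT hPd (P.L ^ k) c fun i => P.L ^ k * M0 i) →
        (∀ i, R₀ + R ≤ (boxCoord hPd (P.L ^ k) c (x₂.shift μ) i : ℝ) ∧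
          (boxCoord hPd (P.L ^ k) c (x₂.shift μ) i : ℝ) + (R₀ + R) ≤ (P.L ^ k * M0 i : ℕ) - 1) →
      ∀ (l : List (Balaban1983to89.Site P 0)), IsSChain x₁ l → pathEnd x₁ l = x₂ →
        (l.length : ℝ) ≤ ((d : ℝ) + 1) * B5Ineq137Torus.T P 0 x₁ x₂ →
      ∀ (f : Balaban1983to89.Site P 0 → ℂ) (F D : ℝ), (∀ y, ‖f y‖ ≤ F) → 0 ≤ D →
        (∀ y, f y ≠ 0 → D ≤ B5Ineq137Torus.T P 0 x₁ y) → (∀ y, f y ≠ 0 → D ≤ B5Ineq137Torus.T P 0 x₂ y) →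
        ((P.L : ℝ) ^ k / B5Ineq137Torus.T P 0 x₁ x₂) ^ θ *
          ‖holA e A x₁ l *
              covD P.eps⁻¹ (cfg (expGauge P e A))
                (gLocT (B1RG242Torus.α P a k * (P.L : ℝ) ^ (k * P.d)) P.eps⁻¹ (expGauge P e A) k
                  (cubeFamB hPd (P.L ^ k) c M0 sg W (L ^ k * L ^ s)) (lamFam hPd (P.L ^ k) c M0 sg) (zetaPi R₁ R₀ 0) *ᵥ f) ⟨x₂, μ⟩ -
            covD P.eps⁻¹ (cfg (expGauge P e A))
                (gLocT (B1RG242Torus.α P a k * (P.L : ℝ) ^ (k * P.d)) P.eps⁻¹ (expGauge P e A) k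
                  (cubeFamB hPd (P.L ^ k) c M0 sg W (L ^ k * L ^ s)) (lamFam hPd (P.L ^ k) c M0 sg) (zetaPi R₁ R₀ 0) *ᵥ f) ⟨x₁, μ⟩‖ ≤
          P.spacing k * (c₀ * (⌊(((P.L : ℝ) ^ k) - 1 + R₀) / sg⌋₊ + 3) ^ (d + 1) *
            (1 + (P.L : ℝ) ^ k * ((R₀ - R₁)⁻¹ + (sg : ℝ)⁻¹)) ^ 2 * Real.exp (-(1 / (8 * (L : ℝ) ^ s) * (((P.L : ℝ) ^ k)⁻¹ * D))) * F) := by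
  obtain ⟨C, hC0, hC1, hC2⟩ := exists_abs_deriv_and_deriv_deriv_smoothTransition_le
  have hK₂ : 0 ≤ C ^ 2 + C := by positivity
  obtain ⟨s₀, H0⟩ := derivHolder230_regular_of_smooth d L hL ha e creg β hcreg hβ hθ0 hθ1 hC0 hK₂
  refine ⟨s₀, fun s hs => ?_⟩
  obtain ⟨c₀, e₁, hc₀, he₁, H⟩ := H0 s hs
  refine ⟨c₀, e₁, hc₀, he₁, ?_⟩
  intro P hPd hPL k hk1 hkK hks hsize A ec hec hece hreg c M0 hfit0 hN0 sg W hsg R R₀ R₁ hR hR₁ hR10 hR₀N hW hgap x₁ x₂ μ hx₁ hdeep₁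
    hx₁e hdeep₁e hx₂ hdeep₂ hx₂e hdeep₂e l hch hend hlen f F D hF hD hsupp₁ hsupp₂
  have eK : secondDiffConst C R₁ R₀ = (C ^ 2 + C) / (R₀ - R₁) ^ 2 := by rw [secondDiffConst, div_pow, add_div]
  exact H P hPd hPL k hk1 hkK hks hsize A ec hec hece hreg c M0 hfit0 hN0 sg W hsg R R₀ R₁ hR (zero_le_one.trans hR₁) hR10 hW hgap
    (zetaPi R₁ R₀ 0) (abs_zetaPi_zero_le_one R₁ R₀) (zetaPi_zero_eq_zero_of_le hR10) (abs_zetaPi_zero_shift_sub_le hC1 hR10)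
    (fun x y κ ν => (abs_zetaPi_zero_secondDiff_le hC1 hC2 hR10 hR₁ hR₀N x y κ ν).trans_eq eK)
    x₁ x₂ μ hx₁ hdeep₁ hx₁e hdeep₁e hx₂ hdeep₂ hx₂e hdeep₂e l hch hend hlen f F D hF hD hsupp₁ hsupp₂

/-- **THE COVARIANT-DERIVATIVE ANALOGUE OF (2.30) AT A (2.23)-REGULAR `u` FOR THE SMOOTH PRODUCT CUT-OFF `ζ″ = ζ^Π(R₁, R₀)`** (the order-`1`
member for the data of this file; §2 at `K₁ = C_σ`): `‖D_u(G_{k,loc}(u)f)(⟨x,μ⟩)‖ ≤ (L^kε)·c₀·m·(1 + L^k((R₀−R₁)⁻¹ + s_g⁻¹))·e^{−δ₀D/L^k}·F` for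
`R > rowMargin + 1`, `0 ≤ R₁ < R₀`, bond end points at chart depth `≥ R₀ + R`. [cite: BalabanImbrieJaffe1988, (2.30) p.263] -/
theorem deriv230_regular_zetaPi (d L : ℕ) (hL : 2 ≤ L) {a : ℝ} (ha : 0 < a) (e creg β : ℝ) (hcreg : 0 ≤ creg) (hβ : 0 < β) :
    ∃ s₀ : ℕ, ∀ s : ℕ, s₀ ≤ s → ∃ c₀ e₁ : ℝ, 0 < c₀ ∧ 0 < e₁ ∧
      ∀ (P : Params) (hPd : P.d = d + 1), P.L = L → ∀ (k : ℕ), 1 ≤ k → k ≤ P.K → k + s ≤ P.m + P.K →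
      3 * (L ^ k * L ^ s) ≤ P.sitesPerDir 0 →
      ∀ (A : PBond P 0 → ℝ) (ec : ℝ), 0 < ec → ec ≤ e₁ →
      (∀ (z : Balaban1983to89.Site P 0) (μ ν : Fin P.d),
          P.spacing k * |e| / ec * |A ⟨z.shift μ, ν⟩ - A ⟨z, ν⟩| ≤ creg * ec ^ (β - 1) / (L : ℝ) ^ k) →
      ∀ (c M0 : Fin (d + 1) → ℕ), (∀ i, c i * P.L ^ k + P.L ^ k * M0 i ≤ P.sitesPerDir 0) → (∀ i, P.L ^ k * M0 i < P.sitesPerDir 0) →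
      ∀ (sg W : ℕ), 1 ≤ sg → ∀ (R R₀ R₁ : ℝ), ((rowMargin L (d + 1) k s : ℕ) : ℝ) + 1 < R → 0 ≤ R₁ → R₁ < R₀ →
        2 * (sg : ℝ) / 3 + R₀ / 2 + R ≤ W → (∀ i, ((P.L ^ k * M0 i : ℕ) : ℝ) + R ≤ P.sitesPerDir 0) →
      ∀ (x : Balaban1983to89.Site P 0) (μ : Fin P.d),
        x ∈ (cubeT hPd (P.L ^ k) c fun i => P.L ^ k * M0 i) →
        (∀ i, R₀ + R ≤ (boxCoord hPd (P.L ^ k) c x i : ℝ) ∧ (boxCoord hPd (P.L ^ k) c x i : ℝ) + (R₀ + R) ≤ (P.L ^ k * M0 i : ℕ) - 1) →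
        x.shift μ ∈ (cubeT hPd (P.L ^ k) c fun i => P.L ^ k * M0 i) →
        (∀ i, R₀ + R ≤ (boxCoord hPd (P.L ^ k) c (x.shift μ) i : ℝ) ∧
          (boxCoord hPd (P.L ^ k) c (x.shift μ) i : ℝ) + (R₀ + R) ≤ (P.L ^ k * M0 i : ℕ) - 1) →
      ∀ (f : Balaban1983to89.Site P 0 → ℂ) (F D : ℝ), (∀ y, ‖f y‖ ≤ F) → 0 ≤ D → (∀ y, f y ≠ 0 → D ≤ B5Ineq137Torus.T P 0 x y) →
        ‖covD P.eps⁻¹ (cfg (expGauge P e A))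
            (gLocT (B1RG242Torus.α P a k * (P.L : ℝ) ^ (k * P.d)) P.eps⁻¹ (expGauge P e A) k
              (cubeFamB hPd (P.L ^ k) c M0 sg W (L ^ k * L ^ s)) (lamFam hPd (P.L ^ k) c M0 sg) (zetaPi R₁ R₀ 0) *ᵥ f) ⟨x, μ⟩‖ ≤
          P.spacing k * (c₀ * (((⌊(((P.L : ℝ) ^ k) - 1 + R₀) / sg⌋₊ : ℝ) + 3) ^ (d + 1)) *
            (1 + (P.L : ℝ) ^ k * ((R₀ - R₁)⁻¹ + (sg : ℝ)⁻¹)) * Real.exp (-(1 / (8 * (L : ℝ) ^ s) * (((P.L : ℝ) ^ k)⁻¹ * D))) * F) := by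
  obtain ⟨C, hC0, hC1, -⟩ := exists_abs_deriv_and_deriv_deriv_smoothTransition_le
  obtain ⟨s₀, H0⟩ := deriv230_regular_of_lipschitz d L hL ha e creg β hcreg hβ hC0
  refine ⟨s₀, fun s hs => ?_⟩
  obtain ⟨c₀, e₁, hc₀, he₁, H⟩ := H0 s hs
  refine ⟨c₀, e₁, hc₀, he₁, ?_⟩
  intro P hPd hPL k hk1 hkK hks hsize A ec hec hece hreg c M0 hfit0 hN0 sg W hsg R R₀ R₁ hR hR₁ hR10 hW hgap x μ hx hdeep hxe hdeepe
    f F D hF hD hsupp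
  exact H P hPd hPL k hk1 hkK hks hsize A ec hec hece hreg c M0 hfit0 hN0 sg W hsg R R₀ R₁ hR hR₁ hR10 hW hgap (zetaPi R₁ R₀ 0)
    (abs_zetaPi_zero_le_one R₁ R₀) (zetaPi_zero_eq_zero_of_le hR10) (abs_zetaPi_zero_shift_sub_le hC1 hR10) x μ hx hdeep hxe hdeepe
    f F D hF hD hsupp

end ZetaPiMember

end

end Literature.MathematicalPhysics.QuantumFieldTheory.BalabanImbrieJaffe1984to88.BIJ88LocDerivHolder230RegularTorus
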